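import Literature.NumberTheory.LFunctions.KloostermanFractionsOffDiagWeil
import Literature.NumberTheory.LFunctions.TrilinearKloostermanFractionsOffPairPhase
import Literature.NumberTheory.LFunctions.TrilinearKloostermanFractionsAbelMonotone
import HarnessLib

/-!
# Trilinear forms with Kloosterman fractions: Weil's bound for the `n₂`-sum of an off-diagonal pair (Bettin–Chandee §4.1.3, general `A`)

Topic `NumberTheory/LFunctions`.  S. Bettin, V. Chandee, *Trilinear forms with Kloosterman
fractions*, Adv. Math. 328 (2018), §4.1.3, the terms with `Δ ≠ 0`: "we use Weil's bound on the
sum over `n₂'`" — "`G(…) ≪ M^ε (LN^{1/2} + (Δ,n₁')𝔭₁/(b𝔭₁²𝔮₂[d,d'])) (1 + |ϑ|AD/(bLN²))`"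
((gwp)–(boudn)), after removing the smooth twists "by using partial summation".  This file is the
general-`A`, twisted counterpart of the tree's `KloostermanFractionsOffDiagWeil.lean`
(`kfw_class_sum_le`, `kfw_pair_sum_le`: case `A = 1`, `ℓ₂ = ℓ₂'`):

* `BC_class_sum2_le` — the `n₂`-sum over one class with the coprimality side condition
  `(n₂, δ) = 1` for a general `δ` (here `δ = ℓ₂ℓ₂'`):
  `‖∑_{x₁<x≤x₂, x≡V (q), (x,S)=1, (x,δ)=1} e(a x̄/S)‖ ≤ τ(δ) · 2((R+3)(Δ,n₁)/n₁ + τ(S)√S λ (Δ,n₁)^{1/2}(1+log S))`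
  under `(a,n₁) = (Δ,n₁)`, `(a,t₂) ≤ λ²`.

* `BC_pair_twist_identity` — the partial-fraction identity turning the Remark-2 twists and the
  reciprocity twist into `C₀/n₂ + C₁/(ℓ₁n₁−ℓ₂n₂) + C₂/(ℓ₁'n₁−ℓ₂'n₂)`; `BC_pair_sign_abs`,
  `BC_pair_piece_tv`, `BC_pair_piece0_tv` — the monotone pieces and their variation;
* `BC_pair_delta_exists` — the side condition `(n₂, ℓ₂ℓ₂') = 1` on a class modulo
  `q = lcm(b|d|, b|d'|)` (the part of `ℓ₂ℓ₂'` dividing `q` is automatic);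
* `BC_pair_gcd_bound` — `(a, t₂) ≤ λ²` for `t₂ ∣ ℓ₁ℓ₁'` (`λ² = ℓ₁²` if `ℓ₁ = ℓ₁'`, else
  `(a₂, ℓ₁ℓ₁')`: with `a₂ ≤ 2A` possibly divisible by `ℓ₁` when `A ≥ L`);
* **`BC_pair_sum2_le`** — Weil's bound for the `n₂`-sum of a pair
  `(ℓ₁,ℓ₂,d,a₁), (ℓ₁',ℓ₂',d',a₁')` of the trilinear, twisted off-diagonal (two numerators,
  `ℓ₂ ≠ ℓ₂'` allowed, generic case `(ℓ₁ℓ₁', ℓ₂ℓ₂') = 1`), the smooth factor removed by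
  `BC_abel_exp_monotone_le`; the general-`A` counterpart of the tree's `kfw_pair_sum_le`.

No new named facts (D-0026).

## References

* S. Bettin, V. Chandee, Adv. Math. 328 (2018) 1234–1262 (arXiv:1502.00769), §4.1.3
  (gwp)–(boudn). [BettinChandee2018]
* W. Duke, J. Friedlander, H. Iwaniec, Invent. Math. 128 (1997) 23–43, §4. [DukeFriedlanderIwaniec1997]
-/

noncomputable section

open Finset

namespace Literature.NumberTheory.LFunctions

/-- **The `n₂`-sum over one class, bounded by Weil**, general coprimality side condition `δ`
(the tree's `kfw_class_sum_le` has `δ = ℓ₂` prime): see the module docstring.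
[cite: BettinChandee2018, §4.1.3 (gwp)] -/
theorem BC_class_sum2_le {S s₁ s₂ t₂ n₁ q δ : ℕ} (hS : S = s₁ * s₂) (hs₂ : s₂ = t₂ * n₁)
    (hs₁ : 0 < s₁) (ht₂ : 0 < t₂) (hn₁ : 0 < n₁) (hcop : s₁.Coprime s₂) (htn : t₂.Coprime n₁)
    (hq : 0 < q) (hqs : q.Coprime s₂) (hdiv : s₁ ∣ q) (hδ : 0 < δ) (hδq : δ.Coprime q)
    {a Δ : ℤ} (haΔ : Int.gcd a n₁ = Int.gcd Δ n₁) {lam : ℝ} (hlam : 1 ≤ lam)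
    (hat : (Int.gcd a t₂ : ℝ) ≤ lam ^ 2) (V x₁ x₂ : ℤ) (hx : x₁ ≤ x₂) {R : ℝ}
    (hR : ((x₂ - x₁ : ℤ) : ℝ) ≤ R) :
    ‖∑ x ∈ (Finset.Ioc x₁ x₂).filter (fun x : ℤ =>
        x ≡ V [ZMOD q] ∧ (Int.gcd x S = 1 ∧ Int.gcd x δ = 1)),
        Complex.exp (2 * Real.pi * Complex.I *
          ((a : ℂ) * ((((x : ZMod S)⁻¹).val : ℕ) : ℂ) / (S : ℂ)))‖ ≤
      (Nat.divisors δ).card * (2 * ((R + 3) * (Int.gcd Δ n₁ : ℝ) / n₁ +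
        (S.divisors.card : ℝ) * Real.sqrt S * lam * Real.sqrt (Int.gcd Δ n₁) *
          (1 + Real.log S))) := by
  have hs₂0 : 0 < s₂ := by rw [hs₂]; exact Nat.mul_pos ht₂ hn₁
  have hS0 : 0 < S := by rw [hS]; exact Nat.mul_pos hs₁ hs₂0
  have hqm : (q * 1).Coprime s₂ := by rw [mul_one]; exact hqs
  have hdiv' : s₁ ∣ q * 1 := by rw [mul_one]; exact hdiv
  have hδq' : δ.Coprime (q * 1) := by rw [mul_one]; exact hδq
  have h := KI_sum_interval_progression_le hS hs₁ hs₂0 hcop hq zero_lt_one hqm hdiv' hδ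
    hδq' a V x₁ x₂ hx
  refine h.trans ?_
  -- simplify the right-hand side
  have hn₁r : (0 : ℝ) < n₁ := by exact_mod_cast hn₁
  have ht₂r : (0 : ℝ) < t₂ := by exact_mod_cast ht₂
  have hs₂r : (0 : ℝ) < s₂ := by exact_mod_cast hs₂0
  have hqr : (1 : ℝ) ≤ q := by exact_mod_cast hq
  have hg0 : (0 : ℝ) ≤ Int.gcd Δ n₁ := Nat.cast_nonneg _
  -- the gcd: `(a, s₂) = (a, t₂)(a, n₁) ≤ λ² (Δ', n₁)` and `(a, s₂)/s₂ ≤ (Δ', n₁)/n₁`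
  have hgcd_eq : (Int.gcd a s₂ : ℝ) = (Int.gcd a t₂ : ℝ) * Int.gcd Δ n₁ := by
    rw [← haΔ, hs₂, Int.gcd_eq_natAbs, Int.gcd_eq_natAbs, Int.gcd_eq_natAbs, Int.natAbs_natCast,
      Int.natAbs_natCast, Int.natAbs_natCast, Nat.Coprime.gcd_mul _ htn]
    push_cast; ring
  have hat0 : (1 : ℝ) ≤ Int.gcd a t₂ := by
    exact_mod_cast Nat.gcd_pos_of_pos_right _ ht₂
  have hat_le : (Int.gcd a t₂ : ℝ) ≤ t₂ := by
    exact_mod_cast Nat.le_of_dvd ht₂ (by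
      have := Int.gcd_dvd_right a t₂
      exact_mod_cast this)
  have hmain : (Int.gcd a s₂ : ℝ) / s₂ ≤ (Int.gcd Δ n₁ : ℝ) / n₁ := by
    rw [hgcd_eq, hs₂]; push_cast
    rw [div_le_div_iff₀ (by positivity) hn₁r]
    calc (Int.gcd a t₂ : ℝ) * Int.gcd Δ n₁ * n₁ = Int.gcd a t₂ * (Int.gcd Δ n₁ * n₁) := by ring
      _ ≤ t₂ * (Int.gcd Δ n₁ * n₁) := mul_le_mul_of_nonneg_right hat_le (by positivity)
      _ = Int.gcd Δ n₁ * (t₂ * n₁) := by ring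
  have hsqrt_g : Real.sqrt (Int.gcd a s₂) ≤ lam * Real.sqrt (Int.gcd Δ n₁) := by
    rw [hgcd_eq, Real.sqrt_mul (Nat.cast_nonneg _)]
    refine mul_le_mul_of_nonneg_right ?_ (Real.sqrt_nonneg _)
    calc Real.sqrt (Int.gcd a t₂) ≤ Real.sqrt (lam ^ 2) := Real.sqrt_le_sqrt hat
      _ = lam := Real.sqrt_sq (by linarith)
  -- the other factors
  have hτ : ((Nat.divisors s₂).card : ℝ) ≤ S.divisors.card := by
    exact_mod_cast kfw_card_divisors_le_of_dvd hS0.ne' ⟨s₁, by rw [hS, mul_comm]⟩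
  have hsqrt_s : Real.sqrt s₂ ≤ Real.sqrt S := by
    refine Real.sqrt_le_sqrt ?_
    exact_mod_cast Nat.le_of_dvd hS0 ⟨s₁, by rw [hS, mul_comm]⟩
  have hlog : 1 + Real.log s₂ ≤ 1 + Real.log S := by
    have : (s₂ : ℝ) ≤ S := by exact_mod_cast Nat.le_of_dvd hS0 ⟨s₁, by rw [hS, mul_comm]⟩
    have := Real.log_le_log hs₂r this; linarith
  have hlog0 : 0 ≤ 1 + Real.log s₂ := by
    have := Real.log_nonneg (show (1 : ℝ) ≤ s₂ by exact_mod_cast hs₂0); linarith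
  -- the length factor: `((x₂-x₁)/q + 1)/1 + 2 ≤ R + 3`
  have hlen : (((x₂ - x₁ : ℤ) : ℝ) / q + 1) / (1 : ℕ) + 2 ≤ R + 3 := by
    have h0 : (0 : ℝ) ≤ ((x₂ - x₁ : ℤ) : ℝ) := by exact_mod_cast (sub_nonneg.mpr hx)
    have h1 : ((x₂ - x₁ : ℤ) : ℝ) / q ≤ ((x₂ - x₁ : ℤ) : ℝ) := div_le_self h0 hqr
    have h2 : (((x₂ - x₁ : ℤ) : ℝ) / q + 1) / (1 : ℕ) = ((x₂ - x₁ : ℤ) : ℝ) / q + 1 := by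
      push_cast; ring
    rw [h2]; linarith
  have hlen0 : 0 ≤ (((x₂ - x₁ : ℤ) : ℝ) / q + 1) / (1 : ℕ) + 2 := by
    have h0 : (0 : ℝ) ≤ ((x₂ - x₁ : ℤ) : ℝ) := by exact_mod_cast (sub_nonneg.mpr hx)
    positivity
  have hgs0 : (0 : ℝ) ≤ Int.gcd a s₂ := Nat.cast_nonneg _
  -- assemble
  have hterm1 : ((((x₂ - x₁ : ℤ) : ℝ) / q + 1) / (1 : ℕ) + 2) / s₂ * Int.gcd a s₂ ≤
      (R + 3) * (Int.gcd Δ n₁ : ℝ) / n₁ := by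
    calc ((((x₂ - x₁ : ℤ) : ℝ) / q + 1) / (1 : ℕ) + 2) / s₂ * Int.gcd a s₂
        = ((((x₂ - x₁ : ℤ) : ℝ) / q + 1) / (1 : ℕ) + 2) * ((Int.gcd a s₂ : ℝ) / s₂) := by ring
      _ ≤ (R + 3) * ((Int.gcd Δ n₁ : ℝ) / n₁) :=
          mul_le_mul hlen hmain (by positivity) (by linarith)
      _ = (R + 3) * (Int.gcd Δ n₁ : ℝ) / n₁ := by ring
  have hterm2 : ((Nat.divisors s₂).card : ℝ) * Real.sqrt s₂ * Real.sqrt (Int.gcd a s₂) *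
      (1 + Real.log s₂) ≤
      (S.divisors.card : ℝ) * Real.sqrt S * lam * Real.sqrt (Int.gcd Δ n₁) * (1 + Real.log S) := by
    calc ((Nat.divisors s₂).card : ℝ) * Real.sqrt s₂ * Real.sqrt (Int.gcd a s₂) * (1 + Real.log s₂)
        ≤ (S.divisors.card : ℝ) * Real.sqrt S * (lam * Real.sqrt (Int.gcd Δ n₁)) *
            (1 + Real.log S) := by
          gcongr
      _ = _ := by ring
  have hτδ : (0 : ℝ) ≤ (Nat.divisors δ).card := Nat.cast_nonneg _
  calc (1 : ℕ) * ((Nat.divisors δ).card * (((((x₂ - x₁ : ℤ) : ℝ) / q + 1) / (1 : ℕ) + 2) / s₂ * Int.gcd a s₂ +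
          (Nat.divisors s₂).card * Real.sqrt s₂ * Real.sqrt (Int.gcd a s₂) * (1 + Real.log s₂)))
      = (Nat.divisors δ).card * (((((x₂ - x₁ : ℤ) : ℝ) / q + 1) / (1 : ℕ) + 2) / s₂ * Int.gcd a s₂ +
          (Nat.divisors s₂).card * Real.sqrt s₂ * Real.sqrt (Int.gcd a s₂) * (1 + Real.log s₂)) := by
        push_cast; ring
    _ ≤ (Nat.divisors δ).card * (2 * ((R + 3) * (Int.gcd Δ n₁ : ℝ) / n₁ +
          (S.divisors.card : ℝ) * Real.sqrt S * lam * Real.sqrt (Int.gcd Δ n₁) *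
            (1 + Real.log S))) := by
        apply mul_le_mul_of_nonneg_left _ hτδ
        have hsum0 : 0 ≤ (R + 3) * (Int.gcd Δ n₁ : ℝ) / n₁ +
            (S.divisors.card : ℝ) * Real.sqrt S * lam * Real.sqrt (Int.gcd Δ n₁) *
              (1 + Real.log S) := by
          have h1 : 0 ≤ (R + 3) * (Int.gcd Δ n₁ : ℝ) / n₁ := by
            have : 0 ≤ R + 3 := by
              have h0 : (0 : ℝ) ≤ ((x₂ - x₁ : ℤ) : ℝ) := by exact_mod_cast (sub_nonneg.mpr hx)
              linarith
            positivity
          have h2 : 0 ≤ 1 + Real.log (S : ℝ) := hlog0.trans hlog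
          have h3 : 0 ≤ lam := by linarith
          have : 0 ≤ (S.divisors.card : ℝ) * Real.sqrt S * lam * Real.sqrt (Int.gcd Δ n₁) *
              (1 + Real.log S) := by positivity
          linarith
        linarith



/-- The partial-fraction identity behind the smooth phase of a pair:
with `u = ℓ₁n₁ − ℓ₂x`, `u' = ℓ₁'n₁ − ℓ₂'x` (so `ℓ₂ = (ℓ₁n₁ − u)/x`, `ℓ₂' = (ℓ₁'n₁ − u')/x`),
`ηa₁/((u/d)bn₁) − ηa₂/((u/d)bx) − (ηa₁'/((u'/d')bn₁) − ηa₂/((u'/d')bx)) + θ/x = C₀/x + C₁/u + C₂/u'`.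
[folklore] -/
theorem BC_pair_twist_identity (η θ a₁ a₁' a₂ b n₁ x ℓ₁ ℓ₁' u u' d d' : ℝ) (hx : x ≠ 0)
    (hb : b ≠ 0) (hn₁ : n₁ ≠ 0) (hℓ₁ : ℓ₁ ≠ 0) (hℓ₁' : ℓ₁' ≠ 0) (hu : u ≠ 0) (hu' : u' ≠ 0) :
    η * a₁ / (u / d * (b * n₁)) - η * a₂ / (u / d * (b * x)) -
        (η * a₁' / (u' / d' * (b * n₁)) - η * a₂ / (u' / d' * (b * x))) + θ / x =
      (θ - η * d * a₂ / (b * ℓ₁ * n₁) + η * d' * a₂ / (b * ℓ₁' * n₁)) / x +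
        η * d * (a₁ / (b * n₁) - a₂ * ((ℓ₁ * n₁ - u) / x) / (b * ℓ₁ * n₁)) / u +
        -(η * d' * (a₁' / (b * n₁) - a₂ * ((ℓ₁' * n₁ - u') / x) / (b * ℓ₁' * n₁))) / u' := by
  field_simp
  ring

/-- Sign and size of an affine complementary divisor on an interval where `M₁ < (ln₁ − l₂x)/dd`:
the sign of `ln₁ − l₂x` is that of `dd`, and `|dd| M₁ < |ln₁ − l₂x|`. [folklore] -/
theorem BC_pair_sign_abs (l l₂ n₁ M₁ : ℕ) {dd : ℤ} (hdd : dd ≠ 0) (hM₁ : 1 ≤ M₁) (x₁ x₂ : ℤ)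
    (hR : ∀ x : ℤ, x ∈ Set.Icc (x₁ + 1) x₂ →
      (M₁ : ℝ) < (((l * n₁ : ℕ) : ℝ) - (l₂ : ℝ) * x) / (dd : ℝ)) :
    ((∀ x : ℤ, x ∈ Set.Icc (x₁ + 1) x₂ → 0 < ((l * n₁ : ℕ) : ℝ) - (l₂ : ℝ) * x) ∨
       (∀ x : ℤ, x ∈ Set.Icc (x₁ + 1) x₂ → ((l * n₁ : ℕ) : ℝ) - (l₂ : ℝ) * x < 0)) ∧
      (∀ x : ℤ, x ∈ Set.Icc (x₁ + 1) x₂ → (|dd| : ℝ) * M₁ < |((l * n₁ : ℕ) : ℝ) - (l₂ : ℝ) * x|) := by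
  have hM₁r : (0 : ℝ) < M₁ := by exact_mod_cast hM₁
  rcases lt_or_gt_of_ne hdd with hneg | hpos
  · have hddr : (dd : ℝ) < 0 := by exact_mod_cast hneg
    have hw : ∀ x : ℤ, x ∈ Set.Icc (x₁ + 1) x₂ → ((l * n₁ : ℕ) : ℝ) - (l₂ : ℝ) * x < 0 := by
      intro x hx
      have h := hR x hx
      by_contra hcon
      push Not at hcon
      have : (((l * n₁ : ℕ) : ℝ) - (l₂ : ℝ) * x) / (dd : ℝ) ≤ 0 :=
        div_nonpos_iff.mpr (Or.inl ⟨hcon, hddr.le⟩)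
      linarith
    refine ⟨Or.inr hw, fun x hx => ?_⟩
    have h := hR x hx
    rw [abs_of_neg hddr, abs_of_neg (hw x hx)]
    have := (lt_div_iff_of_neg hddr).mp h
    linarith
  · have hddr : (0 : ℝ) < (dd : ℝ) := by exact_mod_cast hpos
    have hw : ∀ x : ℤ, x ∈ Set.Icc (x₁ + 1) x₂ → 0 < ((l * n₁ : ℕ) : ℝ) - (l₂ : ℝ) * x := by
      intro x hx
      have h := hR x hx
      have := (lt_div_iff₀ hddr).mp h
      nlinarith
    refine ⟨Or.inl hw, fun x hx => ?_⟩
    have h := hR x hx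
    rw [abs_of_pos hddr, abs_of_pos (hw x hx), mul_comm]
    exact (lt_div_iff₀ hddr).mp h

/-- The variation of a piece `C/(ln₁ − l₂x)` between the endpoints is at most `2|C|/(|dd|M₁)`.
[folklore] -/
theorem BC_pair_piece_tv (C : ℝ) (l l₂ n₁ M₁ : ℕ) (hM₁ : 1 ≤ M₁) {dd : ℤ} (hdd : dd ≠ 0)
    (y z : ℤ)
    (hy : (|dd| : ℝ) * M₁ < |((l * n₁ : ℕ) : ℝ) - (l₂ : ℝ) * y|)
    (hz : (|dd| : ℝ) * M₁ < |((l * n₁ : ℕ) : ℝ) - (l₂ : ℝ) * z|) :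
    |C / (((l * n₁ : ℕ) : ℝ) - (l₂ : ℝ) * (y : ℝ)) - C / (((l * n₁ : ℕ) : ℝ) - (l₂ : ℝ) * (z : ℝ))| ≤
      2 * |C| / ((|dd| : ℝ) * M₁) := by
  have hM₁r : (0 : ℝ) < M₁ := by exact_mod_cast hM₁
  have hddM : (0 : ℝ) < (|dd| : ℝ) * M₁ := mul_pos (abs_pos.mpr (by exact_mod_cast hdd)) hM₁r
  have hone : ∀ w : ℝ, (|dd| : ℝ) * M₁ < |w| → |C / w| ≤ |C| / ((|dd| : ℝ) * M₁) := by
    intro w hw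
    rw [abs_div]
    exact div_le_div_of_nonneg_left (abs_nonneg _) hddM hw.le
  calc _ ≤ |C / (((l * n₁ : ℕ) : ℝ) - (l₂ : ℝ) * (y : ℝ))| +
        |C / (((l * n₁ : ℕ) : ℝ) - (l₂ : ℝ) * (z : ℝ))| := abs_sub _ _
    _ ≤ |C| / ((|dd| : ℝ) * M₁) + |C| / ((|dd| : ℝ) * M₁) := add_le_add (hone _ hy) (hone _ hz)
    _ = 2 * |C| / ((|dd| : ℝ) * M₁) := by ring

/-- The variation of the piece `C₀/x` on `[x₁+1, x₂]`, `x₁ ≥ N₁ ≥ 0`: `≤ |C₀|/(N₁+1)`. [folklore] -/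
theorem BC_pair_piece0_tv (C₀ : ℝ) (N₁ : ℕ) {x₁ x₂ : ℤ} (hx₁ : (N₁ : ℤ) ≤ x₁) (hx : x₁ + 1 ≤ x₂) :
    |C₀ / ((x₁ + 1 : ℤ) : ℝ) - C₀ / ((x₂ : ℤ) : ℝ)| ≤ |C₀| / ((N₁ : ℝ) + 1) := by
  have hx₁pos : 0 < x₁ + 1 := by
    have : (0 : ℤ) ≤ N₁ := by positivity
    omega
  have hx1r : (0 : ℝ) < ((x₁ + 1 : ℤ) : ℝ) := by exact_mod_cast hx₁pos
  have hx2r : ((x₁ + 1 : ℤ) : ℝ) ≤ ((x₂ : ℤ) : ℝ) := by exact_mod_cast hx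
  have hN1r : (N₁ : ℝ) + 1 ≤ ((x₁ + 1 : ℤ) : ℝ) := by
    push_cast
    have : (N₁ : ℝ) ≤ x₁ := by exact_mod_cast hx₁
    linarith
  have e : C₀ / ((x₁ + 1 : ℤ) : ℝ) - C₀ / ((x₂ : ℤ) : ℝ) =
      C₀ * (1 / ((x₁ + 1 : ℤ) : ℝ) - 1 / ((x₂ : ℤ) : ℝ)) := by ring
  rw [e, abs_mul]
  have hdiff0 : 0 ≤ 1 / ((x₁ + 1 : ℤ) : ℝ) - 1 / ((x₂ : ℤ) : ℝ) := by
    have := one_div_le_one_div_of_le hx1r hx2r; linarith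
  have hdiff1 : 1 / ((x₁ + 1 : ℤ) : ℝ) - 1 / ((x₂ : ℤ) : ℝ) ≤ 1 / ((N₁ : ℝ) + 1) := by
    have h1 := one_div_le_one_div_of_le (by positivity : (0 : ℝ) < (N₁ : ℝ) + 1) hN1r
    have h2 : 0 ≤ 1 / ((x₂ : ℤ) : ℝ) := by
      have : (0 : ℝ) < ((x₂ : ℤ) : ℝ) := lt_of_lt_of_le hx1r hx2r
      positivity
    linarith
  rw [abs_of_nonneg hdiff0]
  calc |C₀| * (1 / ((x₁ + 1 : ℤ) : ℝ) - 1 / ((x₂ : ℤ) : ℝ)) ≤ |C₀| * (1 / ((N₁ : ℝ) + 1)) :=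
        mul_le_mul_of_nonneg_left hdiff1 (abs_nonneg _)
    _ = |C₀| / ((N₁ : ℝ) + 1) := by ring

/-- **The side condition `(x, ℓ₂ℓ₂') = 1` on a class**: with `q = lcm(b|d|, b|d'|)`, the part of
`ℓ₂ℓ₂'` dividing `q` is automatic on the class of a witness `n₀` coprime to `ℓ₂ℓ₂'`, and the rest
`δ` is coprime to `q`. [folklore] -/
theorem BC_pair_delta_exists {b ℓ₂ ℓ₂' : ℕ} (hp₂ : ℓ₂.Prime) (hp₂' : ℓ₂'.Prime)
    (hℓ₂b : ℓ₂.Coprime b) (hℓ₂'b : ℓ₂'.Coprime b) {d d' : ℤ}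
    (hℓq₁ : ℓ₂.Coprime (b * d.natAbs)) (hℓq₂ : ℓ₂'.Coprime (b * d'.natAbs)) {n₀ : ℤ}
    (hn₀ℓ₂ : Int.gcd n₀ ℓ₂ = 1) (hn₀ℓ₂' : Int.gcd n₀ ℓ₂' = 1) :
    ∃ δ : ℕ, 0 < δ ∧ δ.Coprime (Nat.lcm (b * d.natAbs) (b * d'.natAbs)) ∧ δ ∣ ℓ₂ * ℓ₂' ∧
      ∀ x : ℤ, x ≡ n₀ [ZMOD (Nat.lcm (b * d.natAbs) (b * d'.natAbs) : ℕ)] →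
        (Int.gcd x (ℓ₂ * ℓ₂' : ℕ) = 1 ↔ Int.gcd x δ = 1) := by
  set q : ℕ := Nat.lcm (b * d.natAbs) (b * d'.natAbs) with hqdef
  have hgcd_mul_iff : ∀ x : ℤ, Int.gcd x (ℓ₂ * ℓ₂' : ℕ) = 1 ↔ (Int.gcd x ℓ₂ = 1 ∧ Int.gcd x ℓ₂' = 1) := by
    intro x
    simp only [Int.gcd_eq_natAbs, Int.natAbs_natCast]
    exact Nat.coprime_mul_iff_right
  have hqcop : ∀ m : ℕ, m.Coprime b → m.Coprime d.natAbs → m.Coprime d'.natAbs → m.Coprime q := by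
    intro m hmb hmd hmd'
    refine Nat.Coprime.coprime_dvd_right (Nat.lcm_dvd_mul _ _) ?_
    exact Nat.Coprime.mul_right (Nat.Coprime.mul_right hmb hmd) (Nat.Coprime.mul_right hmb hmd')
  have hauto : ∀ (p : ℕ), p ∣ q → Int.gcd n₀ p = 1 → ∀ x : ℤ, x ≡ n₀ [ZMOD q] →
      Int.gcd x p = 1 := by
    intro p hpq hn₀p x hx
    have hpq' : (p : ℤ) ∣ (q : ℤ) := Int.natCast_dvd_natCast.mpr hpq
    rw [kfw_gcd_eq_of_modEq (Int.ModEq.of_dvd hpq' hx)]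
    exact hn₀p
  have hℓ₂d_nat : ℓ₂.Coprime d.natAbs := Nat.Coprime.coprime_mul_left_right hℓq₁
  have hℓ₂'d'_nat : ℓ₂'.Coprime d'.natAbs := Nat.Coprime.coprime_mul_left_right hℓq₂
  by_cases h1 : ℓ₂ ∣ d'.natAbs
  · have h1q : ℓ₂ ∣ q := (h1.trans (dvd_mul_left _ b)).trans (Nat.dvd_lcm_right _ _)
    by_cases h2 : ℓ₂' ∣ d.natAbs
    · have h2q : ℓ₂' ∣ q := (h2.trans (dvd_mul_left _ b)).trans (Nat.dvd_lcm_left _ _)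
      refine ⟨1, zero_lt_one, Nat.coprime_one_left _, one_dvd _, fun x hx => ?_⟩
      rw [hgcd_mul_iff]
      simp only [Nat.cast_one, Int.gcd_one_right, iff_true]
      exact ⟨hauto ℓ₂ h1q hn₀ℓ₂ x hx, hauto ℓ₂' h2q hn₀ℓ₂' x hx⟩
    · have hℓ₂'q : ℓ₂'.Coprime q := hqcop ℓ₂' hℓ₂'b
        ((Nat.Prime.coprime_iff_not_dvd hp₂').mpr h2) hℓ₂'d'_nat
      refine ⟨ℓ₂', hp₂'.pos, hℓ₂'q, dvd_mul_left _ _, fun x hx => ?_⟩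
      rw [hgcd_mul_iff]
      exact ⟨fun h => h.2, fun h => ⟨hauto ℓ₂ h1q hn₀ℓ₂ x hx, h⟩⟩
  · have hℓ₂q : ℓ₂.Coprime q := hqcop ℓ₂ hℓ₂b hℓ₂d_nat
      ((Nat.Prime.coprime_iff_not_dvd hp₂).mpr h1)
    by_cases h2 : ℓ₂' ∣ d.natAbs
    · have h2q : ℓ₂' ∣ q := (h2.trans (dvd_mul_left _ b)).trans (Nat.dvd_lcm_left _ _)
      refine ⟨ℓ₂, hp₂.pos, hℓ₂q, dvd_mul_right _ _, fun x hx => ?_⟩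
      rw [hgcd_mul_iff]
      exact ⟨fun h => h.1, fun h => ⟨h, hauto ℓ₂' h2q hn₀ℓ₂' x hx⟩⟩
    · have hℓ₂'q : ℓ₂'.Coprime q := hqcop ℓ₂' hℓ₂'b
        ((Nat.Prime.coprime_iff_not_dvd hp₂').mpr h2) hℓ₂'d'_nat
      refine ⟨ℓ₂ * ℓ₂', Nat.mul_pos hp₂.pos hp₂'.pos, Nat.Coprime.mul_left hℓ₂q hℓ₂'q, dvd_rfl,
        fun x _ => Iff.rfl⟩

/-- **The gcd of the pair frequency with `ℓ₁ℓ₁'`** (from `a·bℓ₂ℓ₂' ≡ ϑΔ (mod S)`): for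
`t₂ ∣ ℓ₁ℓ₁'`, `(a, t₂) ≤ λ²` with `λ² = ℓ₁²` if `ℓ₁ = ℓ₁'` and `(a₂, ℓ₁ℓ₁')` otherwise
(a prime `p ∈ {ℓ₁, ℓ₁'}` dividing `a` divides `Δ`, hence `a₂ Y₂ ℓ₂ℓ₂'`, hence `a₂` — since
`p ∤ ℓ₂ℓ₂'` and `p ∣ Y₂ = dℓ₁' − d'ℓ₁` would force `p ∣ d` resp. `p ∣ d'`). [folklore] -/
theorem BC_pair_gcd_bound (ϑ a : ℤ) (a₁ a₁' a₂ b : ℕ) {ℓ₁ ℓ₁' ℓ₂ ℓ₂' n₁ : ℕ}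
    (hp₁ : ℓ₁.Prime) (hp₁' : ℓ₁'.Prime) (hp₂ : ℓ₂.Prime) (hp₂' : ℓ₂'.Prime)
    (h12 : ℓ₁ ≠ ℓ₂) (h12' : ℓ₁' ≠ ℓ₂') (hx21 : ℓ₂' ≠ ℓ₁) (hx12 : ℓ₂ ≠ ℓ₁')
    (hℓ₁k : Int.gcd ϑ ℓ₁ = 1) (hℓ₁'k : Int.gcd ϑ ℓ₁' = 1) {d d' : ℤ}
    (hℓ₁d : ¬ ((ℓ₁ : ℤ) ∣ d)) (hℓ₁'d' : ¬ ((ℓ₁' : ℤ) ∣ d'))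
    (hfreqS : a * ((b * (ℓ₂ * ℓ₂') : ℕ) : ℤ) ≡
      ϑ * ((a₂ : ℤ) * (d * ℓ₁' - d' * ℓ₁) * (ℓ₂ * ℓ₂' : ℕ) -
        ((a₁ : ℤ) * d * ℓ₂' - (a₁' : ℤ) * d' * ℓ₂) * (ℓ₁ * ℓ₁' : ℕ)) [ZMOD (ℓ₁ * ℓ₁' * n₁ : ℕ)]) :
    ∀ t₂ : ℕ, t₂ ∣ ℓ₁ * ℓ₁' → 0 < t₂ → (Int.gcd a t₂ : ℝ) ≤
      (if ℓ₁ = ℓ₁' then ((ℓ₁ : ℝ)) ^ 2 else ((Nat.gcd a₂ (ℓ₁ * ℓ₁') : ℕ) : ℝ)) := by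
  set Y : ℤ := d * ℓ₁' - d' * ℓ₁ with hY
  set Δ : ℤ := (a₂ : ℤ) * (d * ℓ₁' - d' * ℓ₁) * (ℓ₂ * ℓ₂' : ℕ) -
    ((a₁ : ℤ) * d * ℓ₂' - (a₁' : ℤ) * d' * ℓ₂) * (ℓ₁ * ℓ₁' : ℕ) with hΔ
  have ht : 0 < ℓ₁ * ℓ₁' := Nat.mul_pos hp₁.pos hp₁'.pos
  -- primes as integers
  have hprime_dvd : ∀ (p : ℕ), p.Prime → ∀ (u v : ℤ), Int.gcd u p = 1 → (p : ℤ) ∣ u * v →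
      (p : ℤ) ∣ v := by
    intro p hp u v hu huv
    have hcop : IsCoprime (p : ℤ) u := by
      rw [Int.isCoprime_iff_gcd_eq_one, Int.gcd_comm]; exact hu
    exact hcop.dvd_of_dvd_mul_left huv
  have hgcd_prime : ∀ (p p' : ℕ), p.Prime → p'.Prime → p ≠ p' → Int.gcd (p' : ℤ) p = 1 := by
    intro p p' hp hp' hne
    rw [Int.gcd_natCast_natCast]
    exact (Nat.coprime_primes hp' hp).mpr (Ne.symm hne)
  have hΔdvd : ∀ (p : ℕ), p.Prime → (p ∣ ℓ₁ * ℓ₁') → Int.gcd ϑ p = 1 → (p : ℤ) ∣ a →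
      (p : ℤ) ∣ Δ := by
    intro p hp hpS hkp hpa
    have hpS' : (p : ℤ) ∣ ((ℓ₁ * ℓ₁' * n₁ : ℕ) : ℤ) :=
      Int.natCast_dvd_natCast.mpr (hpS.trans ⟨n₁, rfl⟩)
    have h1 : a * ((b * (ℓ₂ * ℓ₂') : ℕ) : ℤ) ≡ ϑ * Δ [ZMOD p] := Int.ModEq.of_dvd hpS' hfreqS
    have h2 : (p : ℤ) ∣ ϑ * Δ := by
      have h3 : (p : ℤ) ∣ a * ((b * (ℓ₂ * ℓ₂') : ℕ) : ℤ) := hpa.mul_right _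
      have := (Int.modEq_iff_dvd.mp h1)
      have h4 : ϑ * Δ = (ϑ * Δ - a * ((b * (ℓ₂ * ℓ₂') : ℕ) : ℤ)) + a * ((b * (ℓ₂ * ℓ₂') : ℕ) : ℤ) := by
        ring
      rw [h4]; exact dvd_add this h3
    exact hprime_dvd p hp ϑ Δ hkp h2
  have ha₂dvd : ℓ₁ ≠ ℓ₁' → ∀ (p : ℕ), p.Prime → (p = ℓ₁ ∨ p = ℓ₁') → (p : ℤ) ∣ a → p ∣ a₂ := by
    intro hℓeq p hp hpℓ hpa
    have hpS : p ∣ ℓ₁ * ℓ₁' := by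
      rcases hpℓ with hp1 | hp1
      · rw [hp1]; exact dvd_mul_right _ _
      · rw [hp1]; exact dvd_mul_left _ _
    have hkp : Int.gcd ϑ p = 1 := by
      rcases hpℓ with hp1 | hp1
      · rw [hp1]; exact hℓ₁k
      · rw [hp1]; exact hℓ₁'k
    have h1 : (p : ℤ) ∣ Δ := hΔdvd p hp hpS hkp hpa
    -- `p ∣ a₂ Y ℓ₂ ℓ₂'`
    have h2 : (p : ℤ) ∣ (a₂ : ℤ) * Y * (ℓ₂ * ℓ₂' : ℕ) := by
      have : (a₂ : ℤ) * Y * (ℓ₂ * ℓ₂' : ℕ) = Δ + ((a₁ : ℤ) * d * ℓ₂' - (a₁' : ℤ) * d' * ℓ₂) * (ℓ₁ * ℓ₁' : ℕ) := by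
        rw [hΔ, hY]; ring
      rw [this]
      refine dvd_add h1 (Dvd.dvd.mul_left ?_ _)
      exact_mod_cast hpS
    -- `p ∤ ℓ₂ ℓ₂'` and `p ∤ Y`
    have hpℓ₂ : Int.gcd ((ℓ₂ * ℓ₂' : ℕ) : ℤ) p = 1 := by
      rw [Int.gcd_natCast_natCast]
      rcases hpℓ with hp1 | hp1
      · rw [hp1]
        exact Nat.Coprime.mul_left ((Nat.coprime_primes hp₂ hp₁).mpr h12.symm)
          ((Nat.coprime_primes hp₂' hp₁).mpr hx21)
      · rw [hp1]
        exact Nat.Coprime.mul_left ((Nat.coprime_primes hp₂ hp₁').mpr hx12)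
          ((Nat.coprime_primes hp₂' hp₁').mpr h12'.symm)
    have h3 : (p : ℤ) ∣ (a₂ : ℤ) * Y := by
      rw [mul_comm] at h2
      exact hprime_dvd p hp _ _ hpℓ₂ h2
    have hpY : ¬ ((p : ℤ) ∣ Y) := by
      intro hY'
      rcases hpℓ with hp1 | hp1
      · -- `ℓ₁ ∣ d ℓ₁'`
        rw [hp1] at hY'
        have h4 : (ℓ₁ : ℤ) ∣ d * ℓ₁' := by
          have : d * ℓ₁' = Y + d' * ℓ₁ := by rw [hY]; ring
          rw [this]; exact dvd_add hY' (Dvd.intro_left d' rfl)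
        have h5 : (ℓ₁ : ℤ) ∣ d := by
          rw [mul_comm] at h4
          exact hprime_dvd ℓ₁ hp₁ ℓ₁' d (hgcd_prime ℓ₁ ℓ₁' hp₁ hp₁' hℓeq) h4
        exact hℓ₁d h5
      · rw [hp1] at hY'
        have h4 : (ℓ₁' : ℤ) ∣ d' * ℓ₁ := by
          have : d' * ℓ₁ = d * ℓ₁' - Y := by rw [hY]; ring
          rw [this]; exact dvd_sub (Dvd.intro_left d rfl) hY'
        have h5 : (ℓ₁' : ℤ) ∣ d' := by
          rw [mul_comm] at h4
          exact hprime_dvd ℓ₁' hp₁' ℓ₁ d' (hgcd_prime ℓ₁' ℓ₁ hp₁' hp₁ (Ne.symm hℓeq)) h4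
        exact hℓ₁'d' h5
    have h4 : (p : ℤ) ∣ (a₂ : ℤ) := by
      rcases (Int.Prime.dvd_mul' hp h3) with h5 | h5
      · exact h5
      · exact absurd h5 hpY
    exact Int.natCast_dvd_natCast.mp h4
  -- `(a, t₂) ≤ λ²` for `t₂ ∣ ℓ₁ℓ₁'`
  intro t₂ ht₂ ht₂0
  by_cases hℓeq : ℓ₁ = ℓ₁'
  · rw [if_pos hℓeq]
    have h1 : Int.gcd a t₂ ≤ t₂ := Nat.le_of_dvd ht₂0 (by
      have := Int.gcd_dvd_right a t₂; exact_mod_cast this)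
    have h2 : t₂ ≤ ℓ₁ * ℓ₁' := Nat.le_of_dvd ht ht₂
    calc (Int.gcd a t₂ : ℝ) ≤ t₂ := by exact_mod_cast h1
      _ ≤ ((ℓ₁ * ℓ₁' : ℕ) : ℝ) := by exact_mod_cast h2
      _ = (ℓ₁ : ℝ) ^ 2 := by rw [← hℓeq]; push_cast; ring
  · rw [if_neg hℓeq]
    -- `(a, t₂) ∣ (a₂, ℓ₁ℓ₁')`
    have hgdvd : Int.gcd a t₂ ∣ Nat.gcd a₂ (ℓ₁ * ℓ₁') := by
      have hgt : Int.gcd a t₂ ∣ ℓ₁ * ℓ₁' := by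
        have : Int.gcd a t₂ ∣ t₂ := by
          have := Int.gcd_dvd_right a t₂; exact_mod_cast this
        exact this.trans ht₂
      -- write the gcd as `d₁ d₂` with `d₁ ∣ ℓ₁`, `d₂ ∣ ℓ₁'`
      obtain ⟨d₁, d₂, hd₁, hd₂, hprod⟩ := (Nat.dvd_mul.mp hgt)
      have hga : ((Int.gcd a t₂ : ℕ) : ℤ) ∣ a := Int.gcd_dvd_left a t₂
      have hd₁a₂ : d₁ ∣ Nat.gcd a₂ (ℓ₁ * ℓ₁') := by
        rcases (Nat.dvd_prime hp₁).mp hd₁ with h1 | h1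
        · rw [h1]; exact one_dvd _
        · rw [h1]
          refine Nat.dvd_gcd ?_ (dvd_mul_right _ _)
          refine ha₂dvd hℓeq ℓ₁ hp₁ (Or.inl rfl) ?_
          exact (Int.natCast_dvd_natCast.mpr (hprod ▸ h1 ▸ dvd_mul_right d₁ d₂ : ℓ₁ ∣ Int.gcd a t₂)).trans hga
      have hd₂a₂ : d₂ ∣ Nat.gcd a₂ (ℓ₁ * ℓ₁') := by
        rcases (Nat.dvd_prime hp₁').mp hd₂ with h1 | h1
        · rw [h1]; exact one_dvd _
        · rw [h1]
          refine Nat.dvd_gcd ?_ (dvd_mul_left _ _)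
          refine ha₂dvd hℓeq ℓ₁' hp₁' (Or.inr rfl) ?_
          exact (Int.natCast_dvd_natCast.mpr (hprod ▸ h1 ▸ dvd_mul_left d₂ d₁ : ℓ₁' ∣ Int.gcd a t₂)).trans hga
      have hcop12 : d₁.Coprime d₂ := by
        refine Nat.Coprime.coprime_dvd_left hd₁ (Nat.Coprime.coprime_dvd_right hd₂ ?_)
        exact (Nat.coprime_primes hp₁ hp₁').mpr hℓeq
      rw [← hprod]
      exact Nat.Coprime.mul_dvd_of_dvd_of_dvd hcop12 hd₁a₂ hd₂a₂
    have hgpos : 0 < Nat.gcd a₂ (ℓ₁ * ℓ₁') := Nat.gcd_pos_of_pos_right _ ht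
    exact_mod_cast Nat.le_of_dvd hgpos hgdvd


set_option maxHeartbeats 8000000 in
/-- **Weil's bound for the `n₂`-sum of an off-diagonal pair, general `A`, twisted**
(Bettin–Chandee §4.1.3, the terms `Δ ≠ 0`; `𝔭ᵢ = 𝔮ᵢ = 1`; generic case `(ℓ₁ℓ₁', ℓ₂ℓ₂') = 1`;
explicit constants).  Fix `ϑ`, `η`, `a₁, a₁', a₂`, `b ≥ 1`, primes `ℓ₁, ℓ₁', ℓ₂, ℓ₂'` coprime to
`b` (`ℓ₁, ℓ₁'` coprime to `ϑ`, `ℓ₂' ≠ ℓ₁`, `ℓ₂ ≠ ℓ₁'`), `n₁ ≥ 1` coprime to `bϑ`, `c`, `1 ≤ M₁`,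
`M₂`, `N₁ ≤ N₂`, `d, d' ≠ 0`.  With `S = ℓ₁ℓ₁'n₁`, `Y₂ = dℓ₁' − d'ℓ₁`,
`Δ = a₂Y₂ℓ₂ℓ₂' − (a₁dℓ₂' − a₁'d'ℓ₂)ℓ₁ℓ₁'` (the source's `Δ`), `λ² = ℓ₁²` if `ℓ₁ = ℓ₁'` and
`(a₂, ℓ₁ℓ₁')` otherwise, the sum over `N₁ < n₂ ≤ N₂`, `(n₂,b) = 1` of
`[NDC ∧ NDC'] [A ∧ A'] · (twist of Remark 2) · (the four Kloosterman-fraction phases of BC_off_msum_tuple_eq)`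
has norm at most
`τ(ℓ₂ℓ₂') 2((N₂−N₁+3)(Δ,n₁)/n₁ + τ(S)√S λ (Δ,n₁)^{1/2}(1+log S)) · (1 + 2π(|C₀|/(N₁+1) + 2|C₁|/(|d|M₁) + 2|C₂|/(|d'|M₁)))`,
where `C₀/n₂ + C₁/(ℓ₁n₁−ℓ₂n₂) + C₂/(ℓ₁'n₁−ℓ₂'n₂)` is the total smooth phase (reciprocity twist
`−ϑa₂Y₂/(bSn₂)` plus the Remark-2 twists, after partial fractions), removed by partial summation
(`BC_abel_exp_monotone_le`). [cite: BettinChandee2018, §4.1.3 (gwp)–(boudn), Remark 2] -/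
theorem BC_pair_sum2_le (ϑ : ℤ) (η : ℝ) (a₁ a₁' a₂ : ℕ) {b : ℕ} (hb : 0 < b)
    {ℓ₁ ℓ₁' ℓ₂ ℓ₂' : ℕ} (hp₁ : ℓ₁.Prime) (hp₁' : ℓ₁'.Prime) (hp₂ : ℓ₂.Prime) (hp₂' : ℓ₂'.Prime)
    (hℓ₁b : ℓ₁.Coprime b) (hℓ₁'b : ℓ₁'.Coprime b) (hℓ₂b : ℓ₂.Coprime b) (hℓ₂'b : ℓ₂'.Coprime b)
    (hℓ₁k : Int.gcd ϑ ℓ₁ = 1) (hℓ₁'k : Int.gcd ϑ ℓ₁' = 1) (hx21 : ℓ₂' ≠ ℓ₁) (hx12 : ℓ₂ ≠ ℓ₁')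
    {n₁ : ℕ} (hn₁ : 0 < n₁) (hn₁b : n₁.Coprime b) (hn₁k : Int.gcd ϑ n₁ = 1)
    {d d' : ℤ} (hd : d ≠ 0) (hd' : d' ≠ 0) (c M₁ M₂ N₁ N₂ : ℕ) (hN : N₁ ≤ N₂) (hM₁ : 1 ≤ M₁) :
    ‖∑ n₂ ∈ (Finset.Ioc N₁ N₂).filter (fun n => n.Coprime b),
        (if ((ℓ₁ ≠ ℓ₂ ∧ n₁.Coprime n₂ ∧ (n₁ * n₂).Coprime (ℓ₁ * ℓ₂)) ∧
              (ℓ₁' ≠ ℓ₂' ∧ n₁.Coprime n₂ ∧ (n₁ * n₂).Coprime (ℓ₁' * ℓ₂'))) then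
          (if ((d ∣ ((ℓ₁ * n₁ : ℤ) - ℓ₂ * n₂) ∧ (M₁ : ℤ) < ((ℓ₁ * n₁ : ℤ) - ℓ₂ * n₂) / d ∧
                  ((ℓ₁ * n₁ : ℤ) - ℓ₂ * n₂) / d ≤ M₂ ∧
                  ((ℓ₁ * n₁ : ℤ) - ℓ₂ * n₂) / d ≡ (c : ℤ) [ZMOD b]) ∧
               (d' ∣ ((ℓ₁' * n₁ : ℤ) - ℓ₂' * n₂) ∧ (M₁ : ℤ) < ((ℓ₁' * n₁ : ℤ) - ℓ₂' * n₂) / d' ∧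
                  ((ℓ₁' * n₁ : ℤ) - ℓ₂' * n₂) / d' ≤ M₂ ∧
                  ((ℓ₁' * n₁ : ℤ) - ℓ₂' * n₂) / d' ≡ (c : ℤ) [ZMOD b])) then
            ((Complex.exp (2 * Real.pi * Complex.I *
                  ((η : ℂ) * (a₁ : ℂ) / (((((((ℓ₁ * n₁ : ℤ) - ℓ₂ * n₂) / d).toNat) : ℕ) : ℂ) * ((b * n₁ : ℕ) : ℂ)))) *
                (starRingEnd ℂ) (Complex.exp (2 * Real.pi * Complex.I *
                  ((η : ℂ) * (a₂ : ℂ) / (((((((ℓ₁ * n₁ : ℤ) - ℓ₂ * n₂) / d).toNat) : ℕ) : ℂ) * ((b * n₂ : ℕ) : ℂ)))))) *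
              (starRingEnd ℂ) (Complex.exp (2 * Real.pi * Complex.I *
                  ((η : ℂ) * (a₁' : ℂ) / (((((((ℓ₁' * n₁ : ℤ) - ℓ₂' * n₂) / d').toNat) : ℕ) : ℂ) * ((b * n₁ : ℕ) : ℂ)))) *
                (starRingEnd ℂ) (Complex.exp (2 * Real.pi * Complex.I *
                  ((η : ℂ) * (a₂ : ℂ) / (((((((ℓ₁' * n₁ : ℤ) - ℓ₂' * n₂) / d').toNat) : ℕ) : ℂ) * ((b * n₂ : ℕ) : ℂ))))))) *
            ((Complex.exp (2 * Real.pi * Complex.I *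
                  (((-(ϑ * a₁ * d) : ℤ) : ℂ) * (((((b * (ℓ₂ * n₂ : ℤ) : ℤ) : ZMod n₁)⁻¹).val : ℕ) : ℂ) /
                    (n₁ : ℂ))) *
                (starRingEnd ℂ) (Complex.exp (2 * Real.pi * Complex.I *
                  (((-(ϑ * a₂ * d) : ℤ) : ℂ) *
                    (((((b * (-(ℓ₁ * n₁ : ℤ)) : ℤ) : ZMod n₂)⁻¹).val : ℕ) : ℂ) / (n₂ : ℂ))))) *
              (starRingEnd ℂ) (Complex.exp (2 * Real.pi * Complex.I *
                  (((-(ϑ * a₁' * d') : ℤ) : ℂ) * (((((b * (ℓ₂' * n₂ : ℤ) : ℤ) : ZMod n₁)⁻¹).val : ℕ) : ℂ) /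
                    (n₁ : ℂ))) *
                (starRingEnd ℂ) (Complex.exp (2 * Real.pi * Complex.I *
                  (((-(ϑ * a₂ * d') : ℤ) : ℂ) *
                    (((((b * (-(ℓ₁' * n₁ : ℤ)) : ℤ) : ZMod n₂)⁻¹).val : ℕ) : ℂ) / (n₂ : ℂ))))))
          else 0)
        else 0)‖ ≤
      ((Nat.divisors (ℓ₂ * ℓ₂')).card : ℝ) * (2 * (((N₂ : ℝ) - N₁ + 3) *
            (Int.gcd ((a₂ : ℤ) * (d * ℓ₁' - d' * ℓ₁) * (ℓ₂ * ℓ₂' : ℕ) - ((a₁ : ℤ) * d * ℓ₂' - (a₁' : ℤ) * d' * ℓ₂) * (ℓ₁ * ℓ₁' : ℕ)) n₁ : ℝ) / n₁ +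
          (((ℓ₁ * ℓ₁' * n₁ : ℕ)).divisors.card : ℝ) * Real.sqrt (((ℓ₁ * ℓ₁' * n₁ : ℕ)) : ℝ) *
            Real.sqrt (if ℓ₁ = ℓ₁' then ((ℓ₁ : ℝ)) ^ 2 else ((Nat.gcd a₂ (ℓ₁ * ℓ₁') : ℕ) : ℝ)) *
            Real.sqrt (Int.gcd ((a₂ : ℤ) * (d * ℓ₁' - d' * ℓ₁) * (ℓ₂ * ℓ₂' : ℕ) - ((a₁ : ℤ) * d * ℓ₂' - (a₁' : ℤ) * d' * ℓ₂) * (ℓ₁ * ℓ₁' : ℕ)) n₁ : ℝ) *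
            (1 + Real.log (((ℓ₁ * ℓ₁' * n₁ : ℕ)) : ℝ)))) *
        (1 + 2 * Real.pi * (|(-((ϑ : ℝ) * a₂ * (((d * ℓ₁' - d' * ℓ₁ : ℤ)) : ℝ)) / ((b : ℝ) * ((ℓ₁ * ℓ₁' * n₁ : ℕ))) - η * d * a₂ / ((b : ℝ) * ℓ₁ * n₁) +
            η * d' * a₂ / ((b : ℝ) * ℓ₁' * n₁))| / ((N₁ : ℝ) + 1) +
          2 * |(η * d * ((a₁ : ℝ) / ((b : ℝ) * n₁) - (a₂ : ℝ) * ℓ₂ / ((b : ℝ) * ℓ₁ * n₁)))| / ((|d| : ℝ) * M₁) +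
          2 * |(-(η * d' * ((a₁' : ℝ) / ((b : ℝ) * n₁) - (a₂ : ℝ) * ℓ₂' / ((b : ℝ) * ℓ₁' * n₁))))| / ((|d'| : ℝ) * M₁))) := by
  classical
  -- notation
  set S : ℕ := ℓ₁ * ℓ₁' * n₁ with hSdef
  set Y : ℤ := d * ℓ₁' - d' * ℓ₁ with hY
  set Y₁ : ℤ := ϑ * a₁ * d * ℓ₂' - ϑ * a₁' * d' * ℓ₂ with hY₁
  set Δ : ℤ := (a₂ : ℤ) * (d * ℓ₁' - d' * ℓ₁) * (ℓ₂ * ℓ₂' : ℕ) -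
    ((a₁ : ℤ) * d * ℓ₂' - (a₁' : ℤ) * d' * ℓ₂) * (ℓ₁ * ℓ₁' : ℕ) with hΔ
  set lamsq : ℝ := (if ℓ₁ = ℓ₁' then ((ℓ₁ : ℝ)) ^ 2 else ((Nat.gcd a₂ (ℓ₁ * ℓ₁') : ℕ) : ℝ))
    with hlamsq
  set lam : ℝ := Real.sqrt lamsq with hlam
  set C₀ : ℝ := (-((ϑ : ℝ) * a₂ * (((d * ℓ₁' - d' * ℓ₁ : ℤ)) : ℝ)) / ((b : ℝ) * ((ℓ₁ * ℓ₁' * n₁ : ℕ))) - η * d * a₂ / ((b : ℝ) * ℓ₁ * n₁) +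
            η * d' * a₂ / ((b : ℝ) * ℓ₁' * n₁)) with hC₀
  set C₁ : ℝ := (η * d * ((a₁ : ℝ) / ((b : ℝ) * n₁) - (a₂ : ℝ) * ℓ₂ / ((b : ℝ) * ℓ₁ * n₁))) with hC₁
  set C₂ : ℝ := (-(η * d' * ((a₁' : ℝ) / ((b : ℝ) * n₁) - (a₂ : ℝ) * ℓ₂' / ((b : ℝ) * ℓ₁' * n₁)))) with hC₂
  set TWF : ℝ := (1 + 2 * Real.pi * (|C₀| / ((N₁ : ℝ) + 1) + 2 * |C₁| / ((|d| : ℝ) * M₁) +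
    2 * |C₂| / ((|d'| : ℝ) * M₁))) with hTWF
  set B' : ℝ := ((Nat.divisors (ℓ₂ * ℓ₂')).card : ℝ) * (2 * (((N₂ : ℝ) - N₁ + 3) *
      (Int.gcd Δ n₁ : ℝ) / n₁ +
    (S.divisors.card : ℝ) * Real.sqrt (S : ℝ) * lam * Real.sqrt (Int.gcd Δ n₁ : ℝ) *
      (1 + Real.log (S : ℝ)))) with hB'
  set RHS : ℝ := B' * TWF with hRHS
  have hS0 : 0 < S := Nat.mul_pos (Nat.mul_pos hp₁.pos hp₁'.pos) hn₁
  have hS1 : 1 < S := by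
    calc 1 < 2 * 2 * 1 := by norm_num
      _ ≤ ℓ₁ * ℓ₁' * n₁ := Nat.mul_le_mul (Nat.mul_le_mul hp₁.two_le hp₁'.two_le) hn₁
  have hlamsq1 : 1 ≤ lamsq := by
    rw [hlamsq]; split_ifs
    · have : (2 : ℝ) ≤ ℓ₁ := by exact_mod_cast hp₁.two_le
      nlinarith
    · have : 0 < Nat.gcd a₂ (ℓ₁ * ℓ₁') := Nat.gcd_pos_of_pos_right _ (Nat.mul_pos hp₁.pos hp₁'.pos)
      exact_mod_cast this
  have hlam1 : 1 ≤ lam := by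
    rw [hlam]; exact Real.one_le_sqrt.mpr hlamsq1
  have hlam_sq : lam ^ 2 = lamsq := by
    rw [hlam, Real.sq_sqrt (by linarith)]
  have hTWF1 : 1 ≤ TWF := by
    rw [hTWF]
    have : 0 ≤ 2 * Real.pi * (|C₀| / ((N₁ : ℝ) + 1) + 2 * |C₁| / ((|d| : ℝ) * M₁) +
        2 * |C₂| / ((|d'| : ℝ) * M₁)) := by positivity
    linarith
  have hB'0 : 0 ≤ B' := by
    have h1 : 0 ≤ (N₂ : ℝ) - N₁ + 3 := by
      have : (N₁ : ℝ) ≤ N₂ := by exact_mod_cast hN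
      linarith
    have h2 : 0 ≤ 1 + Real.log (S : ℝ) := by
      have := Real.log_nonneg (show (1 : ℝ) ≤ S by exact_mod_cast hS0); linarith
    have h3 : 0 ≤ lam := le_trans zero_le_one hlam1
    rw [hB']; positivity
  have hRHS0 : 0 ≤ RHS := by rw [hRHS]; exact mul_nonneg hB'0 (by linarith)
  show _ ≤ RHS
  set T₂ := (Finset.Ioc N₁ N₂).filter (fun n => n.Coprime b) with hT₂
  -- the predicates
  set NDC : ℕ → ℕ → ℕ → Prop := fun l l₂ n₂ => l ≠ l₂ ∧ n₁.Coprime n₂ ∧ (n₁ * n₂).Coprime (l * l₂)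
    with hNDC
  set Acond : ℕ → ℕ → ℤ → ℕ → Prop := fun l l₂ dd n₂ =>
    dd ∣ ((l * n₁ : ℤ) - l₂ * n₂) ∧ (M₁ : ℤ) < ((l * n₁ : ℤ) - l₂ * n₂) / dd ∧
      ((l * n₁ : ℤ) - l₂ * n₂) / dd ≤ M₂ ∧ ((l * n₁ : ℤ) - l₂ * n₂) / dd ≡ (c : ℤ) [ZMOD b]
    with hAcond
  -- the twist factors and the Kloosterman phases, as functions of `n₂`
  set TWfun : ℕ → ℂ := fun n₂ => ((Complex.exp (2 * Real.pi * Complex.I *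
                  ((η : ℂ) * (a₁ : ℂ) / (((((((ℓ₁ * n₁ : ℤ) - ℓ₂ * n₂) / d).toNat) : ℕ) : ℂ) * ((b * n₁ : ℕ) : ℂ)))) *
                (starRingEnd ℂ) (Complex.exp (2 * Real.pi * Complex.I *
                  ((η : ℂ) * (a₂ : ℂ) / (((((((ℓ₁ * n₁ : ℤ) - ℓ₂ * n₂) / d).toNat) : ℕ) : ℂ) * ((b * n₂ : ℕ) : ℂ)))))) *
              (starRingEnd ℂ) (Complex.exp (2 * Real.pi * Complex.I *
                  ((η : ℂ) * (a₁' : ℂ) / (((((((ℓ₁' * n₁ : ℤ) - ℓ₂' * n₂) / d').toNat) : ℕ) : ℂ) * ((b * n₁ : ℕ) : ℂ)))) *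
                (starRingEnd ℂ) (Complex.exp (2 * Real.pi * Complex.I *
                  ((η : ℂ) * (a₂ : ℂ) / (((((((ℓ₁' * n₁ : ℤ) - ℓ₂' * n₂) / d').toNat) : ℕ) : ℂ) * ((b * n₂ : ℕ) : ℂ))))))) with hTWfun
  set P : ℕ → ℂ := fun n₂ => ((Complex.exp (2 * Real.pi * Complex.I *
                  (((-(ϑ * a₁ * d) : ℤ) : ℂ) * (((((b * (ℓ₂ * n₂ : ℤ) : ℤ) : ZMod n₁)⁻¹).val : ℕ) : ℂ) /
                    (n₁ : ℂ))) *
                (starRingEnd ℂ) (Complex.exp (2 * Real.pi * Complex.I *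
                  (((-(ϑ * a₂ * d) : ℤ) : ℂ) *
                    (((((b * (-(ℓ₁ * n₁ : ℤ)) : ℤ) : ZMod n₂)⁻¹).val : ℕ) : ℂ) / (n₂ : ℂ))))) *
              (starRingEnd ℂ) (Complex.exp (2 * Real.pi * Complex.I *
                  (((-(ϑ * a₁' * d') : ℤ) : ℂ) * (((((b * (ℓ₂' * n₂ : ℤ) : ℤ) : ZMod n₁)⁻¹).val : ℕ) : ℂ) /
                    (n₁ : ℂ))) *
                (starRingEnd ℂ) (Complex.exp (2 * Real.pi * Complex.I *
                  (((-(ϑ * a₂ * d') : ℤ) : ℂ) *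
                    (((((b * (-(ℓ₁' * n₁ : ℤ)) : ℤ) : ZMod n₂)⁻¹).val : ℕ) : ℂ) / (n₂ : ℂ)))))) with hP
  show ‖∑ n₂ ∈ T₂, (if (NDC ℓ₁ ℓ₂ n₂ ∧ NDC ℓ₁' ℓ₂' n₂) then
      (if (Acond ℓ₁ ℓ₂ d n₂ ∧ Acond ℓ₁' ℓ₂' d' n₂) then TWfun n₂ * P n₂ else 0) else 0)‖ ≤ RHS
  -- Step 1: if no `n₂` satisfies all conditions, the sum vanishes
  by_cases hex : ∃ n₂ ∈ T₂, (NDC ℓ₁ ℓ₂ n₂ ∧ NDC ℓ₁' ℓ₂' n₂) ∧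
      (Acond ℓ₁ ℓ₂ d n₂ ∧ Acond ℓ₁' ℓ₂' d' n₂)
  swap
  · rw [Finset.sum_eq_zero, norm_zero]
    · exact hRHS0
    intro n₂ hn₂
    push Not at hex
    by_cases h1 : NDC ℓ₁ ℓ₂ n₂ ∧ NDC ℓ₁' ℓ₂' n₂
    · have h2 := hex n₂ hn₂ h1
      rw [if_pos h1, if_neg (fun h => h2 h.1 h.2)]
    · rw [if_neg h1]
  obtain ⟨n₀, hn₀T, ⟨hNDC₀, hNDC₀'⟩, ⟨hA₀, hA₀'⟩⟩ := hex
  simp only [hNDC] at hNDC₀ hNDC₀'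
  simp only [hAcond] at hA₀ hA₀'
  obtain ⟨hne₁, hn₁n₀, hcop₀⟩ := hNDC₀
  obtain ⟨hne₁', -, hcop₀'⟩ := hNDC₀'
  -- the good facts, from the witness `n₀`
  have hκ₁ : n₁.Coprime (ℓ₁ * ℓ₂) := Nat.Coprime.coprime_mul_right hcop₀
  have hκ₁' : n₁.Coprime (ℓ₁' * ℓ₂') := Nat.Coprime.coprime_mul_right hcop₀'
  have hn₀ℓ : n₀.Coprime (ℓ₁ * ℓ₂) := Nat.Coprime.coprime_mul_left hcop₀
  have hn₀ℓ' : n₀.Coprime (ℓ₁' * ℓ₂') := Nat.Coprime.coprime_mul_left hcop₀'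
  have hn₁ℓ₂ : n₁.Coprime ℓ₂ := Nat.Coprime.coprime_mul_left_right hκ₁
  have hn₁ℓ₂' : n₁.Coprime ℓ₂' := Nat.Coprime.coprime_mul_left_right hκ₁'
  have hn₁ℓ₁ : n₁.Coprime ℓ₁ := Nat.Coprime.coprime_mul_right_right hκ₁
  have hn₁ℓ₁' : n₁.Coprime ℓ₁' := Nat.Coprime.coprime_mul_right_right hκ₁'
  have h12 : ℓ₁ ≠ ℓ₂ := hne₁
  have h12' : ℓ₁' ≠ ℓ₂' := hne₁'
  have hgood : ∀ (l l₂ : ℕ) (dd : ℤ), l.Prime → l₂.Prime → l ≠ l₂ → n₀.Coprime (l * l₂) →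
      n₁.Coprime (l * l₂) → dd ∣ ((l * n₁ : ℤ) - l₂ * n₀) →
      Int.gcd dd n₁ = 1 ∧ ¬ ((l : ℤ) ∣ dd) ∧ Int.gcd dd l₂ = 1 := by
    intro l l₂ dd hl hl₂ hlne hn₀l hn₁l hdd
    have hn₀l' : n₀.Coprime l := Nat.Coprime.coprime_mul_right_right hn₀l
    have hn₁ℓ₂' : n₁.Coprime l₂ := Nat.Coprime.coprime_mul_left_right hn₁l
    have hlℓ₂ : l.Coprime l₂ := (Nat.coprime_primes hl hl₂).mpr hlne
    refine ⟨?_, ?_, ?_⟩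
    · set g := Int.gcd dd n₁ with hg
      have hg1 : (g : ℤ) ∣ (l₂ * n₀ : ℤ) := by
        have h1 : (g : ℤ) ∣ (l * n₁ : ℤ) - l₂ * n₀ := (Int.gcd_dvd_left _ _).trans hdd
        have h2 : (g : ℤ) ∣ (l * n₁ : ℤ) := (Int.gcd_dvd_right _ _).mul_left _
        have : (l₂ * n₀ : ℤ) = l * n₁ - ((l * n₁ : ℤ) - l₂ * n₀) := by ring
        rw [this]; exact dvd_sub h2 h1
      have hg1' : g ∣ l₂ * n₀ := by exact_mod_cast hg1
      have hg2 : g ∣ n₁ := by have := Int.gcd_dvd_right dd n₁; exact_mod_cast this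
      have hc : (l₂ * n₀).Coprime n₁ := Nat.Coprime.mul_left hn₁ℓ₂'.symm hn₁n₀.symm
      have := Nat.dvd_gcd hg1' hg2
      rwa [Nat.Coprime.gcd_eq_one hc, Nat.dvd_one] at this
    · intro hl1
      have h1 : (l : ℤ) ∣ (l * n₁ : ℤ) - l₂ * n₀ := hl1.trans hdd
      have h2 : (l : ℤ) ∣ (l₂ * n₀ : ℤ) := by
        have : (l₂ * n₀ : ℤ) = l * n₁ - ((l * n₁ : ℤ) - l₂ * n₀) := by ring
        rw [this]; exact dvd_sub (dvd_mul_right _ _) h1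
      have h3 : l ∣ l₂ * n₀ := by exact_mod_cast h2
      rcases (Nat.Prime.dvd_mul hl).mp h3 with h4 | h4
      · exact hlne ((Nat.prime_dvd_prime_iff_eq hl hl₂).mp h4)
      · exact (Nat.Prime.coprime_iff_not_dvd hl).mp hn₀l'.symm h4
    · set g := Int.gcd dd l₂ with hg
      have hg1 : (g : ℤ) ∣ (l * n₁ : ℤ) := by
        have h1 : (g : ℤ) ∣ (l * n₁ : ℤ) - l₂ * n₀ := (Int.gcd_dvd_left _ _).trans hdd
        have h2 : (g : ℤ) ∣ (l₂ * n₀ : ℤ) := (Int.gcd_dvd_right _ _).mul_right _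
        have : (l * n₁ : ℤ) = ((l * n₁ : ℤ) - l₂ * n₀) + l₂ * n₀ := by ring
        rw [this]; exact dvd_add h1 h2
      have hg1' : g ∣ l * n₁ := by exact_mod_cast hg1
      have hg2 : g ∣ l₂ := by have := Int.gcd_dvd_right dd l₂; exact_mod_cast this
      have hc : (l * n₁).Coprime l₂ := Nat.Coprime.mul_left hlℓ₂ hn₁ℓ₂'
      have := Nat.dvd_gcd hg1' hg2
      rwa [Nat.Coprime.gcd_eq_one hc, Nat.dvd_one] at this
  obtain ⟨hdn₁, hℓ₁d, hdℓ₂⟩ := hgood ℓ₁ ℓ₂ d hp₁ hp₂ h12 hn₀ℓ hκ₁ hA₀.1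
  obtain ⟨hd'n₁, hℓ₁'d', hd'ℓ₂'⟩ := hgood ℓ₁' ℓ₂' d' hp₁' hp₂' h12' hn₀ℓ' hκ₁' hA₀'.1
  -- more coprimality
  have hc₁ : (b * (ℓ₂ * ℓ₂')).Coprime n₁ :=
    Nat.Coprime.mul_left hn₁b.symm (Nat.Coprime.mul_left hn₁ℓ₂.symm hn₁ℓ₂'.symm)
  have hbS : b.Coprime S := by
    rw [hSdef]
    exact Nat.Coprime.mul_right (Nat.Coprime.mul_right hℓ₁b.symm hℓ₁'b.symm) hn₁b.symm
  have ht : 0 < ℓ₁ * ℓ₁' := Nat.mul_pos hp₁.pos hp₁'.pos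
  have htn₁ : (ℓ₁ * ℓ₁').Coprime n₁ := Nat.Coprime.mul_left hn₁ℓ₁.symm hn₁ℓ₁'.symm
  -- Step 2: the phases (`BC_pair_final2`) and the twist as a real phase
  set σ₁ : ℕ := (((b * (ℓ₂ * ℓ₂') : ℕ) : ZMod n₁)⁻¹).val with hσ₁
  set σ : ℕ := ((b : ZMod S)⁻¹).val with hσ
  set a : ℤ := (-Y₁) * σ₁ * (ℓ₁ * ℓ₁' : ℕ) + (ϑ * a₂ * Y) * σ with ha
  set Cb : ℤ → ℂ := fun x => Complex.exp (2 * Real.pi * Complex.I *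
    (((ϑ * a₂ * Y : ℤ) : ℂ) * ((((((x * (S : ℕ) : ℤ)) : ZMod b)⁻¹).val : ℕ) : ℂ) / (b : ℂ))) with hCb
  set g : ℤ → ℂ := fun x => Complex.exp (2 * Real.pi * Complex.I *
    ((a : ℂ) * ((((x : ZMod S)⁻¹).val : ℕ) : ℂ) / (S : ℂ))) with hg
  -- the three monotone pieces of the smooth phase
  set ρ : Fin 3 → ℤ → ℝ := ![fun x => C₀ / (x : ℝ),
    fun x => C₁ / (((ℓ₁ * n₁ : ℕ) : ℝ) - (ℓ₂ : ℝ) * (x : ℝ)),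
    fun x => C₂ / (((ℓ₁' * n₁ : ℕ) : ℝ) - (ℓ₂' : ℝ) * (x : ℝ))] with hρ
  set F : ℤ → ℂ := fun x => Complex.exp (2 * Real.pi * Complex.I *
    ((∑ i ∈ (Finset.univ : Finset (Fin 3)), ρ i x : ℝ) : ℂ)) with hF
  have hsumρ : ∀ x : ℤ, (∑ i ∈ (Finset.univ : Finset (Fin 3)), ρ i x) =
      C₀ / (x : ℝ) + C₁ / (((ℓ₁ * n₁ : ℕ) : ℝ) - (ℓ₂ : ℝ) * (x : ℝ)) +
        C₂ / (((ℓ₁' * n₁ : ℕ) : ℝ) - (ℓ₂' : ℝ) * (x : ℝ)) := by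
    intro x
    rw [Fin.sum_univ_three]
    simp only [hρ, Matrix.cons_val_zero, Matrix.cons_val_one, Matrix.head_cons,
      Matrix.cons_val_two, Matrix.tail_cons]
  -- on the support, `TWfun n₂ · e(−ϑa₂Y/(bSn₂)) = F n₂`
  have htwist : ∀ n₂ : ℕ, 0 < n₂ → d ∣ ((ℓ₁ * n₁ : ℤ) - ℓ₂ * n₂) →
      (M₁ : ℤ) < ((ℓ₁ * n₁ : ℤ) - ℓ₂ * n₂) / d → d' ∣ ((ℓ₁' * n₁ : ℤ) - ℓ₂' * n₂) →
      (M₁ : ℤ) < ((ℓ₁' * n₁ : ℤ) - ℓ₂' * n₂) / d' →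
      TWfun n₂ * Complex.exp (2 * Real.pi * Complex.I *
        (((-(ϑ * a₂ * (d * ℓ₁' - d' * ℓ₁)) : ℤ) : ℂ) / ((b * (ℓ₁ * ℓ₁' * n₁) * n₂ : ℕ) : ℂ))) =
      F (n₂ : ℤ) := by
    intro n₂ hn₂ hdw hMw hdw' hMw'
    have hm₁pos : 0 < ((ℓ₁ * n₁ : ℤ) - ℓ₂ * n₂) / d := lt_of_le_of_lt (by positivity) hMw
    have hm₂pos : 0 < ((ℓ₁' * n₁ : ℤ) - ℓ₂' * n₂) / d' := lt_of_le_of_lt (by positivity) hMw'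
    have hdC : (d : ℂ) ≠ 0 := by exact_mod_cast hd
    have hd'C : (d' : ℂ) ≠ 0 := by exact_mod_cast hd'
    have hm₁ : (((((ℓ₁ * n₁ : ℤ) - ℓ₂ * n₂) / d).toNat : ℕ) : ℂ) =
        ((((ℓ₁ * n₁ : ℤ) - ℓ₂ * n₂ : ℤ)) : ℂ) / (d : ℂ) := by
      have h1 : (((((ℓ₁ * n₁ : ℤ) - ℓ₂ * n₂) / d).toNat : ℕ) : ℤ) = ((ℓ₁ * n₁ : ℤ) - ℓ₂ * n₂) / d :=
        Int.toNat_of_nonneg hm₁pos.le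
      have h2 : (((ℓ₁ * n₁ : ℤ) - ℓ₂ * n₂) / d) * d = (ℓ₁ * n₁ : ℤ) - ℓ₂ * n₂ :=
        Int.ediv_mul_cancel hdw
      rw [eq_div_iff hdC]
      have h3 : (((((ℓ₁ * n₁ : ℤ) - ℓ₂ * n₂) / d).toNat : ℕ) : ℤ) * d = (ℓ₁ * n₁ : ℤ) - ℓ₂ * n₂ := by
        rw [h1]; exact h2
      exact_mod_cast h3
    have hm₂ : (((((ℓ₁' * n₁ : ℤ) - ℓ₂' * n₂) / d').toNat : ℕ) : ℂ) =
        ((((ℓ₁' * n₁ : ℤ) - ℓ₂' * n₂ : ℤ)) : ℂ) / (d' : ℂ) := by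
      have h1 : (((((ℓ₁' * n₁ : ℤ) - ℓ₂' * n₂) / d').toNat : ℕ) : ℤ) =
          ((ℓ₁' * n₁ : ℤ) - ℓ₂' * n₂) / d' := Int.toNat_of_nonneg hm₂pos.le
      have h2 : (((ℓ₁' * n₁ : ℤ) - ℓ₂' * n₂) / d') * d' = (ℓ₁' * n₁ : ℤ) - ℓ₂' * n₂ :=
        Int.ediv_mul_cancel hdw'
      rw [eq_div_iff hd'C]
      have h3 : (((((ℓ₁' * n₁ : ℤ) - ℓ₂' * n₂) / d').toNat : ℕ) : ℤ) * d' =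
          (ℓ₁' * n₁ : ℤ) - ℓ₂' * n₂ := by
        rw [h1]; exact h2
      exact_mod_cast h3
    have hw0 : ((ℓ₁ * n₁ : ℤ) - ℓ₂ * n₂) ≠ 0 := by
      intro h; rw [h, Int.zero_ediv] at hm₁pos; exact lt_irrefl _ hm₁pos
    have hw'0 : ((ℓ₁' * n₁ : ℤ) - ℓ₂' * n₂) ≠ 0 := by
      intro h; rw [h, Int.zero_ediv] at hm₂pos; exact lt_irrefl _ hm₂pos
    have hwC : ((ℓ₁ : ℂ) * (n₁ : ℂ) - (ℓ₂ : ℂ) * (n₂ : ℂ)) ≠ 0 := by exact_mod_cast hw0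
    have hw'C : ((ℓ₁' : ℂ) * (n₁ : ℂ) - (ℓ₂' : ℂ) * (n₂ : ℂ)) ≠ 0 := by exact_mod_cast hw'0
    have hwC2 : ((ℓ₁ : ℂ) * (n₁ : ℂ) - (n₂ : ℂ) * (ℓ₂ : ℂ)) ≠ 0 := by rwa [mul_comm (n₂ : ℂ)]
    have hw'C2 : ((ℓ₁' : ℂ) * (n₁ : ℂ) - (n₂ : ℂ) * (ℓ₂' : ℂ)) ≠ 0 := by rwa [mul_comm (n₂ : ℂ)]
    have hbC : (b : ℂ) ≠ 0 := by exact_mod_cast hb.ne'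
    have hn₁C : (n₁ : ℂ) ≠ 0 := by exact_mod_cast hn₁.ne'
    have hn₂C : (n₂ : ℂ) ≠ 0 := by exact_mod_cast hn₂.ne'
    have hℓ₁C : (ℓ₁ : ℂ) ≠ 0 := by exact_mod_cast hp₁.pos.ne'
    have hℓ₁'C : (ℓ₁' : ℂ) ≠ 0 := by exact_mod_cast hp₁'.pos.ne'
    -- everything is `exp` of something: distribute `conj`, then collect
    simp only [hTWfun, hF]
    rw [hm₁, hm₂]
    simp only [map_mul, ← Complex.exp_conj]
    simp only [map_mul, map_div₀, map_neg, Complex.conj_ofReal, Complex.conj_I, map_natCast,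
      map_intCast, map_ofNat]
    simp only [← Complex.exp_add]
    congr 1
    rw [hsumρ]
    -- the real identity
    have hxR : ((n₂ : ℤ) : ℝ) ≠ 0 := by exact_mod_cast hn₂.ne'
    have hbR : (b : ℝ) ≠ 0 := by exact_mod_cast hb.ne'
    have hn₁R : (n₁ : ℝ) ≠ 0 := by exact_mod_cast hn₁.ne'
    have hℓ₁R : (ℓ₁ : ℝ) ≠ 0 := by exact_mod_cast hp₁.pos.ne'
    have hℓ₁'R : (ℓ₁' : ℝ) ≠ 0 := by exact_mod_cast hp₁'.pos.ne'
    have huR : ((((ℓ₁ * n₁ : ℤ) - ℓ₂ * n₂ : ℤ)) : ℝ) ≠ 0 := by exact_mod_cast hw0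
    have hu'R : ((((ℓ₁' * n₁ : ℤ) - ℓ₂' * n₂ : ℤ)) : ℝ) ≠ 0 := by exact_mod_cast hw'0
    have hid := BC_pair_twist_identity η (-((ϑ : ℝ) * a₂ * ((d * ℓ₁' - d' * ℓ₁ : ℤ) : ℝ)) /
        ((b : ℝ) * (ℓ₁ * ℓ₁' * n₁ : ℕ))) a₁ a₁' a₂ b n₁ ((n₂ : ℤ) : ℝ) ℓ₁ ℓ₁'
      ((((ℓ₁ * n₁ : ℤ) - ℓ₂ * n₂ : ℤ)) : ℝ) ((((ℓ₁' * n₁ : ℤ) - ℓ₂' * n₂ : ℤ)) : ℝ) d d'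
      hxR hbR hn₁R hℓ₁R hℓ₁'R huR hu'R
    have e₁ : (((ℓ₁ : ℝ) * n₁ - ((((ℓ₁ * n₁ : ℤ) - ℓ₂ * n₂ : ℤ)) : ℝ)) / ((n₂ : ℤ) : ℝ)) = (ℓ₂ : ℝ) := by
      push_cast; field_simp; ring
    have e₂ : (((ℓ₁' : ℝ) * n₁ - ((((ℓ₁' * n₁ : ℤ) - ℓ₂' * n₂ : ℤ)) : ℝ)) / ((n₂ : ℤ) : ℝ)) = (ℓ₂' : ℝ) := by
      push_cast; field_simp; ring
    rw [e₁, e₂] at hid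
    have hρeq : C₀ / ((n₂ : ℤ) : ℝ) + C₁ / (((ℓ₁ * n₁ : ℕ) : ℝ) - (ℓ₂ : ℝ) * ((n₂ : ℤ) : ℝ)) +
        C₂ / (((ℓ₁' * n₁ : ℕ) : ℝ) - (ℓ₂' : ℝ) * ((n₂ : ℤ) : ℝ)) =
        η * a₁ / (((((ℓ₁ * n₁ : ℤ) - ℓ₂ * n₂ : ℤ)) : ℝ) / d * ((b : ℝ) * n₁)) -
          η * a₂ / (((((ℓ₁ * n₁ : ℤ) - ℓ₂ * n₂ : ℤ)) : ℝ) / d * ((b : ℝ) * ((n₂ : ℤ) : ℝ))) -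
        (η * a₁' / (((((ℓ₁' * n₁ : ℤ) - ℓ₂' * n₂ : ℤ)) : ℝ) / d' * ((b : ℝ) * n₁)) -
          η * a₂ / (((((ℓ₁' * n₁ : ℤ) - ℓ₂' * n₂ : ℤ)) : ℝ) / d' * ((b : ℝ) * ((n₂ : ℤ) : ℝ)))) +
        (-((ϑ : ℝ) * a₂ * ((d * ℓ₁' - d' * ℓ₁ : ℤ) : ℝ)) / ((b : ℝ) * (ℓ₁ * ℓ₁' * n₁ : ℕ))) /
          ((n₂ : ℤ) : ℝ) := by
      rw [hid, hC₀, hC₁, hC₂]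
      have ew : (((ℓ₁ * n₁ : ℕ) : ℝ) - (ℓ₂ : ℝ) * ((n₂ : ℤ) : ℝ)) =
          ((((ℓ₁ * n₁ : ℤ) - ℓ₂ * n₂ : ℤ)) : ℝ) := by push_cast; ring
      have ew' : (((ℓ₁' * n₁ : ℕ) : ℝ) - (ℓ₂' : ℝ) * ((n₂ : ℤ) : ℝ)) =
          ((((ℓ₁' * n₁ : ℤ) - ℓ₂' * n₂ : ℤ)) : ℝ) := by push_cast; ring
      rw [ew, ew']
    rw [hρeq]
    push_cast
    ring
  -- the summand in factored form
  have hpt : ∀ n₂ ∈ T₂, (if (NDC ℓ₁ ℓ₂ n₂ ∧ NDC ℓ₁' ℓ₂' n₂) then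
      (if (Acond ℓ₁ ℓ₂ d n₂ ∧ Acond ℓ₁' ℓ₂' d' n₂) then TWfun n₂ * P n₂ else 0) else 0) =
      (if ((NDC ℓ₁ ℓ₂ n₂ ∧ NDC ℓ₁' ℓ₂' n₂) ∧ (Acond ℓ₁ ℓ₂ d n₂ ∧ Acond ℓ₁' ℓ₂' d' n₂)) then
        Cb (n₂ : ℤ) * (g (n₂ : ℤ) * F (n₂ : ℤ)) else 0) := by
    intro n₂ hn₂
    have hn₂' := Finset.mem_filter.mp hn₂
    have hn₂pos : 0 < n₂ := lt_of_le_of_lt (Nat.zero_le _) (Finset.mem_Ioc.mp hn₂'.1).1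
    by_cases hR : (NDC ℓ₁ ℓ₂ n₂ ∧ NDC ℓ₁' ℓ₂' n₂) ∧ (Acond ℓ₁ ℓ₂ d n₂ ∧ Acond ℓ₁' ℓ₂' d' n₂)
    · rw [if_pos hR.1, if_pos hR.2, if_pos hR]
      obtain ⟨⟨⟨-, hnn, hnl⟩, ⟨-, -, hnl'⟩⟩, ⟨⟨hdw, hMw, -, -⟩, ⟨hdw', hMw', -, -⟩⟩⟩ := hR
      have hn₂ℓ₁ : n₂.Coprime ℓ₁ :=
        Nat.Coprime.coprime_mul_right_right (Nat.Coprime.coprime_mul_left hnl)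
      have hn₂ℓ₁' : n₂.Coprime ℓ₁' :=
        Nat.Coprime.coprime_mul_right_right (Nat.Coprime.coprime_mul_left hnl')
      have hBn : (b * (ℓ₁ * ℓ₁' * n₁)).Coprime n₂ := by
        refine Nat.Coprime.mul_left hn₂'.2.symm ?_
        exact Nat.Coprime.mul_left (Nat.Coprime.mul_left hn₂ℓ₁.symm hn₂ℓ₁'.symm) hnn
      simp only [hP]
      rw [BC_pair_final2 (ϑ * a₁) (ϑ * a₁') (ϑ * a₂) d d' hb hp₁.pos hp₁'.pos hn₁ hn₂pos hS1 hc₁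
        hnn.symm hbS hBn]
      rw [← htwist n₂ hn₂pos hdw hMw hdw' hMw']
      simp only [hCb, hg, ha, hY, hY₁, hσ₁, hσ, hSdef]
      push_cast
      ring
    · rw [if_neg hR]
      by_cases h1 : NDC ℓ₁ ℓ₂ n₂ ∧ NDC ℓ₁' ℓ₂' n₂
      · rw [if_pos h1, if_neg (fun h2 => hR ⟨h1, h2⟩)]
      · rw [if_neg h1]
  rw [Finset.sum_congr rfl hpt]
  -- Step 3: the conditions as a predicate on integers
  set RealJ : ℕ → ℕ → ℤ → ℤ → Prop := fun l l₂ dd x =>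
    (M₁ : ℝ) < (((l * n₁ : ℤ) - l₂ * x : ℤ) : ℝ) / (dd : ℝ) ∧
      (((l * n₁ : ℤ) - l₂ * x : ℤ) : ℝ) / (dd : ℝ) ≤ (M₂ : ℝ) with hRealJ
  set CongD : ℕ → ℕ → ℤ → ℤ → Prop := fun l l₂ dd x =>
    ((b * dd.natAbs : ℕ) : ℤ) ∣ ((l * n₁ : ℤ) - c * dd) - l₂ * x with hCongD
  set Q₂ : ℤ → Prop := fun x => Int.gcd x b = 1 ∧ (Int.gcd x S = 1 ∧ Int.gcd x (ℓ₂ * ℓ₂' : ℕ) = 1) ∧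
    (CongD ℓ₁ ℓ₂ d x ∧ CongD ℓ₁' ℓ₂' d' x) with hQ₂
  set Q : ℤ → Prop := fun x => (RealJ ℓ₁ ℓ₂ d x ∧ RealJ ℓ₁' ℓ₂' d' x) ∧ Q₂ x with hQ
  have hAiff : ∀ (l l₂ : ℕ) (dd : ℤ), dd ≠ 0 → ∀ n₂ : ℕ,
      Acond l l₂ dd n₂ ↔ RealJ l l₂ dd n₂ ∧ CongD l l₂ dd n₂ := by
    intro l l₂ dd hdd n₂
    simp only [hAcond, hRealJ, hCongD]
    rw [kfw_dcond_iff hdd b]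
    have e1 : ((b * dd.natAbs : ℕ) : ℤ) = (b : ℤ) * |dd| := by push_cast; rfl
    have e2 : (l * n₁ : ℤ) - c * dd - l₂ * n₂ = ((l * n₁ : ℤ) - l₂ * n₂) - c * dd := by ring
    rw [e1, e2]
    simp only [Int.cast_natCast]
  have hNiff : ∀ n₂ : ℕ, (NDC ℓ₁ ℓ₂ n₂ ∧ NDC ℓ₁' ℓ₂' n₂) ↔
      (n₂.Coprime S ∧ n₂.Coprime (ℓ₂ * ℓ₂')) := by
    intro n₂
    simp only [hNDC]
    constructor
    · rintro ⟨⟨-, hnn, hnl⟩, ⟨-, -, hnl'⟩⟩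
      have h1 : n₂.Coprime (ℓ₁ * ℓ₂) := Nat.Coprime.coprime_mul_left hnl
      have h2 : n₂.Coprime (ℓ₁' * ℓ₂') := Nat.Coprime.coprime_mul_left hnl'
      refine ⟨?_, Nat.Coprime.mul_right (Nat.Coprime.coprime_mul_left_right h1)
        (Nat.Coprime.coprime_mul_left_right h2)⟩
      rw [hSdef]
      exact Nat.Coprime.mul_right (Nat.Coprime.mul_right
        (Nat.Coprime.coprime_mul_right_right h1) (Nat.Coprime.coprime_mul_right_right h2))
        hnn.symm
    · rintro ⟨hS', hℓ₂₂⟩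
      rw [hSdef] at hS'
      have h1 : n₂.Coprime ℓ₁ := Nat.Coprime.coprime_mul_right_right
        (Nat.Coprime.coprime_mul_right_right hS' : n₂.Coprime (ℓ₁ * ℓ₁'))
      have h2 : n₂.Coprime ℓ₁' := Nat.Coprime.coprime_mul_left_right
        (Nat.Coprime.coprime_mul_right_right hS' : n₂.Coprime (ℓ₁ * ℓ₁'))
      have h3 : n₂.Coprime n₁ := Nat.Coprime.coprime_mul_left_right hS'
      have h4 : n₂.Coprime ℓ₂ := Nat.Coprime.coprime_mul_right_right hℓ₂₂
      have h5 : n₂.Coprime ℓ₂' := Nat.Coprime.coprime_mul_left_right hℓ₂₂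
      exact ⟨⟨h12, h3.symm, Nat.Coprime.mul_left hκ₁ (Nat.Coprime.mul_right h1 h4)⟩,
        ⟨h12', h3.symm, Nat.Coprime.mul_left hκ₁' (Nat.Coprime.mul_right h2 h5)⟩⟩
  have hRQ : ∀ n₂ : ℕ, (n₂.Coprime b ∧ ((NDC ℓ₁ ℓ₂ n₂ ∧ NDC ℓ₁' ℓ₂' n₂) ∧
      (Acond ℓ₁ ℓ₂ d n₂ ∧ Acond ℓ₁' ℓ₂' d' n₂))) ↔ Q (n₂ : ℤ) := by
    intro n₂
    rw [hNiff, hAiff ℓ₁ ℓ₂ d hd, hAiff ℓ₁' ℓ₂' d' hd']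
    simp only [hQ, hQ₂, Nat.coprime_iff_gcd_eq_one, ← Int.gcd_natCast_natCast, Nat.cast_mul]
    constructor
    · rintro ⟨h1, ⟨h2, h3⟩, ⟨h4, h5⟩, ⟨h6, h7⟩⟩
      exact ⟨⟨h4, h6⟩, h1, ⟨h2, h3⟩, h5, h7⟩
    · rintro ⟨⟨h4, h6⟩, h1, ⟨h2, h3⟩, h5, h7⟩
      exact ⟨h1, ⟨h2, h3⟩, ⟨h4, h5⟩, ⟨h6, h7⟩⟩
  have hsumZ : ∑ n₂ ∈ T₂, (if ((NDC ℓ₁ ℓ₂ n₂ ∧ NDC ℓ₁' ℓ₂' n₂) ∧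
      (Acond ℓ₁ ℓ₂ d n₂ ∧ Acond ℓ₁' ℓ₂' d' n₂))
      then Cb (n₂ : ℤ) * (g (n₂ : ℤ) * F (n₂ : ℤ)) else 0) =
      ∑ x ∈ (Finset.Ioc (N₁ : ℤ) (N₂ : ℤ)).filter Q, Cb x * (g x * F x) := by
    rw [hT₂, Finset.sum_filter, Finset.sum_filter]
    rw [← kfw_sum_Ioc_nat_eq_int N₁ N₂ (fun x => if Q x then Cb x * (g x * F x) else 0)]
    refine Finset.sum_congr rfl fun n₂ _ => ?_
    by_cases h1 : n₂.Coprime b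
    · by_cases h2 : (NDC ℓ₁ ℓ₂ n₂ ∧ NDC ℓ₁' ℓ₂' n₂) ∧ (Acond ℓ₁ ℓ₂ d n₂ ∧ Acond ℓ₁' ℓ₂' d' n₂)
      · rw [if_pos h1, if_pos h2, if_pos ((hRQ n₂).mp ⟨h1, h2⟩)]
      · rw [if_pos h1, if_neg h2, if_neg (fun h => h2 ((hRQ n₂).mpr h).2)]
    · rw [if_neg h1, if_neg (fun h => h1 ((hRQ n₂).mpr h).1)]
  rw [hsumZ]
  -- Step 4: the real conditions cut out an interval
  have hconv : ∀ a' b' c' : ℤ, a' ≤ b' → b' ≤ c' →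
      (RealJ ℓ₁ ℓ₂ d a' ∧ RealJ ℓ₁' ℓ₂' d' a') → (RealJ ℓ₁ ℓ₂ d c' ∧ RealJ ℓ₁' ℓ₂' d' c') →
      (RealJ ℓ₁ ℓ₂ d b' ∧ RealJ ℓ₁' ℓ₂' d' b') := by
    intro a' b' c' hab hbc ha' hc
    simp only [hRealJ] at ha' hc ⊢
    push_cast at ha' hc ⊢
    have hdr : (d : ℝ) ≠ 0 := by exact_mod_cast hd
    have hdr' : (d' : ℝ) ≠ 0 := by exact_mod_cast hd'
    exact ⟨kfw_affine_convex _ _ _ _ _ hdr a' b' c' hab hbc ha'.1 hc.1,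
      kfw_affine_convex _ _ _ _ _ hdr' a' b' c' hab hbc ha'.2 hc.2⟩
  obtain ⟨x₁, x₂, hx₁, hx₁₂, hx₂, hIoc⟩ := kfw_convex_filter_eq_Ioc
    (show (N₁ : ℤ) ≤ N₂ by exact_mod_cast hN) (fun x => RealJ ℓ₁ ℓ₂ d x ∧ RealJ ℓ₁' ℓ₂' d' x) hconv
  have hfilt : (Finset.Ioc (N₁ : ℤ) (N₂ : ℤ)).filter Q = (Finset.Ioc x₁ x₂).filter Q₂ := by
    rw [← hIoc, Finset.filter_filter]
  rw [hfilt]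
  -- every integer of `(x₁, x₂]` satisfies the real conditions
  have hRealIoc : ∀ x : ℤ, x ∈ Finset.Ioc x₁ x₂ → RealJ ℓ₁ ℓ₂ d x ∧ RealJ ℓ₁' ℓ₂' d' x := by
    intro x hx
    rw [← hIoc] at hx
    exact (Finset.mem_filter.mp hx).2
  -- Step 5: the witness `(n₀ : ℤ) = n₀` and the single congruence
  have hQn₀ : Q (n₀ : ℤ) := (hRQ n₀).mp ⟨(Finset.mem_filter.mp hn₀T).2,
    ⟨⟨⟨hne₁, hn₁n₀, hcop₀⟩, by simp only [hNDC]; exact ⟨hne₁', hn₁n₀, hcop₀'⟩⟩, ⟨hA₀, hA₀'⟩⟩⟩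
  have hn₀mem : (n₀ : ℤ) ∈ (Finset.Ioc x₁ x₂).filter Q₂ := by
    rw [← hfilt, Finset.mem_filter]
    refine ⟨?_, hQn₀⟩
    have := (Finset.mem_filter.mp hn₀T).1
    rw [Finset.mem_Ioc] at this ⊢
    exact ⟨by exact_mod_cast this.1, by exact_mod_cast this.2⟩
  have hQ₂n₀ : Q₂ (n₀ : ℤ) := (Finset.mem_filter.mp hn₀mem).2
  -- the two congruences
  have hq₁ : 0 < b * d.natAbs := Nat.mul_pos hb (Int.natAbs_pos.mpr hd)
  have hq₂ : 0 < b * d'.natAbs := Nat.mul_pos hb (Int.natAbs_pos.mpr hd')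
  have hℓq₁ : ℓ₂.Coprime (b * d.natAbs) := by
    refine Nat.Coprime.mul_right hℓ₂b ?_
    have h1 : Nat.gcd d.natAbs ℓ₂ = 1 := by
      rw [Int.gcd_eq_natAbs, Int.natAbs_natCast] at hdℓ₂; exact hdℓ₂
    exact Nat.Coprime.symm h1
  have hℓq₂ : ℓ₂'.Coprime (b * d'.natAbs) := by
    refine Nat.Coprime.mul_right hℓ₂'b ?_
    have h1 : Nat.gcd d'.natAbs ℓ₂' = 1 := by
      rw [Int.gcd_eq_natAbs, Int.natAbs_natCast] at hd'ℓ₂'; exact hd'ℓ₂'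
    exact Nat.Coprime.symm h1
  have hCD₁ := fun x => kfw_lin_cong_iff hq₁ hℓq₁ ((ℓ₁ * n₁ : ℤ) - c * d) x
  have hCD₂ := fun x => kfw_lin_cong_iff hq₂ hℓq₂ ((ℓ₁' * n₁ : ℤ) - c * d') x
  have hn₀₁ := (hCD₁ (n₀ : ℤ)).mp hQ₂n₀.2.2.1
  have hn₀₂ := (hCD₂ (n₀ : ℤ)).mp hQ₂n₀.2.2.2
  set q : ℕ := Nat.lcm (b * d.natAbs) (b * d'.natAbs) with hqdef
  have hq : 0 < q := Nat.lcm_pos hq₁ hq₂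
  have htwo : ∀ x : ℤ, (CongD ℓ₁ ℓ₂ d x ∧ CongD ℓ₁' ℓ₂' d' x) ↔ x ≡ (n₀ : ℤ) [ZMOD q] := by
    intro x
    simp only [hCongD]
    rw [hCD₁ x, hCD₂ x]
    exact kfw_two_cong_iff hn₀₁ hn₀₂ x
  have hbq : (b : ℤ) ∣ (q : ℤ) :=
    Int.natCast_dvd_natCast.mpr ((Dvd.intro _ rfl).trans (Nat.dvd_lcm_left _ _))
  have hgcdb : ∀ x : ℤ, x ≡ (n₀ : ℤ) [ZMOD q] → Int.gcd x b = 1 := by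
    intro x hx
    rw [kfw_gcd_eq_of_modEq (Int.ModEq.of_dvd hbq hx)]
    exact hQ₂n₀.1
  have hfilt2 : (Finset.Ioc x₁ x₂).filter Q₂ = (Finset.Ioc x₁ x₂).filter (fun x : ℤ =>
      x ≡ (n₀ : ℤ) [ZMOD q] ∧ (Int.gcd x S = 1 ∧ Int.gcd x (ℓ₂ * ℓ₂' : ℕ) = 1)) := by
    refine Finset.filter_congr fun x _ => ?_
    simp only [hQ₂]
    constructor
    · rintro ⟨_, h2, h3⟩; exact ⟨(htwo x).mp h3, h2⟩
    · rintro ⟨h1, h2⟩; exact ⟨hgcdb x h1, h2, (htwo x).mpr h1⟩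
  rw [hfilt2]
  -- Step 6: the factor `Cb` is constant on the class
  have hCbconst : ∀ x ∈ (Finset.Ioc x₁ x₂).filter (fun x : ℤ =>
      x ≡ (n₀ : ℤ) [ZMOD q] ∧ (Int.gcd x S = 1 ∧ Int.gcd x (ℓ₂ * ℓ₂' : ℕ) = 1)),
      Cb x * (g x * F x) = Cb (n₀ : ℤ) * (g x * F x) := by
    intro x hx
    have h := (Finset.mem_filter.mp hx).2.1
    simp only [hCb]
    rw [kfs_phase_mod_b (ϑ * a₂ * Y) b S (Int.ModEq.of_dvd hbq h)]
  rw [Finset.sum_congr rfl hCbconst, ← Finset.mul_sum, norm_mul]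
  have hCbn : ‖Cb (n₀ : ℤ)‖ = 1 := by
    simp only [hCb]
    have h : 2 * (Real.pi : ℂ) * Complex.I *
        (((ϑ * a₂ * Y : ℤ) : ℂ) * (((((((n₀ : ℤ) * (S : ℕ) : ℤ)) : ZMod b)⁻¹).val : ℕ) : ℂ) / (b : ℂ)) =
        (((2 * Real.pi * (((ϑ * a₂ * Y : ℤ) : ℝ) *
          (((((((n₀ : ℤ) * (S : ℕ) : ℤ)) : ZMod b)⁻¹).val : ℕ) : ℝ)
          / (b : ℝ)) : ℝ)) : ℂ) * Complex.I := by
      push_cast; ring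
    rw [h, Complex.norm_exp_ofReal_mul_I]
  rw [hCbn, one_mul]
  -- Step 7a: the arithmetic of the frequency `a`
  have hfreq := BC_freq_congr2 Y₁ (ϑ * a₂) Y hSdef hn₁ ht hc₁ hbS
  have hfreqS : a * ((b * (ℓ₂ * ℓ₂') : ℕ) : ℤ) ≡ ϑ * Δ [ZMOD S] := by
    rw [← ZMod.intCast_eq_intCast_iff]
    have e : ((ϑ * Δ : ℤ) : ZMod S) = ((ϑ * a₂ * Y * (ℓ₂ * ℓ₂' : ℕ) - Y₁ * (ℓ₁ * ℓ₁' : ℕ) : ℤ) : ZMod S) := by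
      congr 1; rw [hΔ, hY, hY₁]; push_cast; ring
    rw [e]
    simp only [ha, hσ₁, hσ]
    push_cast at hfreq ⊢
    exact hfreq
  have hn₁S : (n₁ : ℤ) ∣ (S : ℤ) := Int.natCast_dvd_natCast.mpr ⟨ℓ₁ * ℓ₁', by rw [hSdef]; ring⟩
  have haΔ : Int.gcd a n₁ = Int.gcd Δ n₁ := by
    refine kfw_gcd_freq_eq (Int.ModEq.of_dvd hn₁S hfreqS) ?_ hn₁k
    rw [Int.gcd_natCast_natCast]; exact hc₁
  have hat' : ∀ t₂ : ℕ, t₂ ∣ ℓ₁ * ℓ₁' → 0 < t₂ → (Int.gcd a t₂ : ℝ) ≤ lam ^ 2 := by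
    intro t₂ ht₂ ht₂0
    rw [hlam_sq, hlamsq]
    have hfreqS' := hfreqS
    rw [hΔ, hSdef] at hfreqS'
    exact BC_pair_gcd_bound ϑ a a₁ a₁' a₂ b hp₁ hp₁' hp₂ hp₂' h12 h12' hx21 hx12 hℓ₁k hℓ₁'k
      hℓ₁d hℓ₁'d' hfreqS' t₂ ht₂ ht₂0
  -- Step 7b: coprimality with `q`
  have hqcop : ∀ m : ℕ, m.Coprime b → m.Coprime d.natAbs → m.Coprime d'.natAbs → m.Coprime q := by
    intro m hmb hmd hmd'
    refine Nat.Coprime.coprime_dvd_right (Nat.lcm_dvd_mul _ _) ?_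
    exact Nat.Coprime.mul_right (Nat.Coprime.mul_right hmb hmd) (Nat.Coprime.mul_right hmb hmd')
  have hn₁d : n₁.Coprime d.natAbs := by
    rw [Int.gcd_eq_natAbs, Int.natAbs_natCast] at hdn₁; exact Nat.Coprime.symm hdn₁
  have hn₁d' : n₁.Coprime d'.natAbs := by
    rw [Int.gcd_eq_natAbs, Int.natAbs_natCast] at hd'n₁; exact Nat.Coprime.symm hd'n₁
  have hℓ₁d_nat : ℓ₁.Coprime d.natAbs :=
    (Nat.Prime.coprime_iff_not_dvd hp₁).mpr (fun h => hℓ₁d (Int.natCast_dvd.mpr h))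
  have hℓ₁'d'_nat : ℓ₁'.Coprime d'.natAbs :=
    (Nat.Prime.coprime_iff_not_dvd hp₁').mpr (fun h => hℓ₁'d' (Int.natCast_dvd.mpr h))
  have hn₁q : n₁.Coprime q := hqcop n₁ hn₁b hn₁d hn₁d'
  -- the side condition `(x, ℓ₂ℓ₂') = 1`: replace `ℓ₂ℓ₂'` by its part `δ` coprime to `q`
  have hn₀ℓ₂ : Int.gcd (n₀ : ℤ) ℓ₂ = 1 := by
    rw [Int.gcd_natCast_natCast]
    exact Nat.Coprime.coprime_mul_left_right (show n₀.Coprime (ℓ₁ * ℓ₂) from hn₀ℓ)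
  have hn₀ℓ₂' : Int.gcd (n₀ : ℤ) ℓ₂' = 1 := by
    rw [Int.gcd_natCast_natCast]
    exact Nat.Coprime.coprime_mul_left_right (show n₀.Coprime (ℓ₁' * ℓ₂') from hn₀ℓ')
  have hδex := BC_pair_delta_exists hp₂ hp₂' hℓ₂b hℓ₂'b hℓq₁ hℓq₂ hn₀ℓ₂ hn₀ℓ₂'
  obtain ⟨δ, hδ0, hδq, hδdvd, hδiff⟩ := hδex
  have hfilt3 : (Finset.Ioc x₁ x₂).filter (fun x : ℤ =>
      x ≡ (n₀ : ℤ) [ZMOD q] ∧ (Int.gcd x S = 1 ∧ Int.gcd x (ℓ₂ * ℓ₂' : ℕ) = 1)) =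
      (Finset.Ioc x₁ x₂).filter (fun x : ℤ =>
      x ≡ (n₀ : ℤ) [ZMOD q] ∧ (Int.gcd x S = 1 ∧ Int.gcd x δ = 1)) := by
    refine Finset.filter_congr fun x _ => ?_
    constructor
    · rintro ⟨h1, h2, h3⟩; exact ⟨h1, h2, (hδiff x h1).mp h3⟩
    · rintro ⟨h1, h2, h3⟩; exact ⟨h1, h2, (hδiff x h1).mpr h3⟩
  rw [hfilt3]
  have hτδ : ((Nat.divisors δ).card : ℝ) ≤ (Nat.divisors (ℓ₂ * ℓ₂')).card := by
    exact_mod_cast kfw_card_divisors_le_of_dvd (Nat.mul_pos hp₂.pos hp₂'.pos).ne' hδdvd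
  -- Step 7c: the class sums (four cases for the factorisation `S = s₁ (t₂ n₁)`)
  have hcases : ∃ s₁ t₂ : ℕ, S = s₁ * (t₂ * n₁) ∧ 0 < s₁ ∧ 0 < t₂ ∧ s₁.Coprime (t₂ * n₁) ∧
      t₂.Coprime n₁ ∧ q.Coprime (t₂ * n₁) ∧ s₁ ∣ q ∧ t₂ ∣ ℓ₁ * ℓ₁' := by
    by_cases h1 : (ℓ₁ : ℤ) ∣ d'
    · -- then `ℓ₁ ≠ ℓ₁'`
      have hne : ℓ₁ ≠ ℓ₁' := fun h => hℓ₁'d' (h ▸ h1)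
      have h1q : ℓ₁ ∣ q := ((Int.natCast_dvd.mp h1).trans (dvd_mul_left _ b)).trans
        (Nat.dvd_lcm_right _ _)
      by_cases h2 : (ℓ₁' : ℤ) ∣ d
      · have h2q : ℓ₁' ∣ q := ((Int.natCast_dvd.mp h2).trans (dvd_mul_left _ b)).trans
          (Nat.dvd_lcm_left _ _)
        refine ⟨ℓ₁ * ℓ₁', 1, by rw [hSdef]; ring, ht, zero_lt_one, ?_, Nat.coprime_one_left _,
          ?_, ?_, one_dvd _⟩
        · rw [one_mul]; exact htn₁
        · rw [one_mul]; exact hn₁q.symm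
        · exact Nat.Coprime.mul_dvd_of_dvd_of_dvd ((Nat.coprime_primes hp₁ hp₁').mpr hne) h1q h2q
      · have hℓ₁'d_nat : ℓ₁'.Coprime d.natAbs :=
          (Nat.Prime.coprime_iff_not_dvd hp₁').mpr (fun h => h2 (Int.natCast_dvd.mpr h))
        have hℓ₁'q : ℓ₁'.Coprime q := hqcop ℓ₁' hℓ₁'b hℓ₁'d_nat hℓ₁'d'_nat
        refine ⟨ℓ₁, ℓ₁', by rw [hSdef]; ring, hp₁.pos, hp₁'.pos, ?_, hn₁ℓ₁'.symm, ?_, h1q,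
          dvd_mul_left _ _⟩
        · exact Nat.Coprime.mul_right ((Nat.coprime_primes hp₁ hp₁').mpr hne) hn₁ℓ₁.symm
        · exact (Nat.Coprime.mul_left hℓ₁'q hn₁q).symm
    · have hℓ₁d'_nat : ℓ₁.Coprime d'.natAbs :=
        (Nat.Prime.coprime_iff_not_dvd hp₁).mpr (fun h => h1 (Int.natCast_dvd.mpr h))
      have hℓ₁q : ℓ₁.Coprime q := hqcop ℓ₁ hℓ₁b hℓ₁d_nat hℓ₁d'_nat
      by_cases h2 : (ℓ₁' : ℤ) ∣ d
      · have hne : ℓ₁ ≠ ℓ₁' := fun h => hℓ₁d (h ▸ h2)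
        have h2q : ℓ₁' ∣ q := ((Int.natCast_dvd.mp h2).trans (dvd_mul_left _ b)).trans
          (Nat.dvd_lcm_left _ _)
        refine ⟨ℓ₁', ℓ₁, by rw [hSdef]; ring, hp₁'.pos, hp₁.pos, ?_, hn₁ℓ₁.symm, ?_, h2q,
          dvd_mul_right _ _⟩
        · exact Nat.Coprime.mul_right ((Nat.coprime_primes hp₁' hp₁).mpr (Ne.symm hne))
            hn₁ℓ₁'.symm
        · exact (Nat.Coprime.mul_left hℓ₁q hn₁q).symm
      · have hℓ₁'d_nat : ℓ₁'.Coprime d.natAbs :=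
          (Nat.Prime.coprime_iff_not_dvd hp₁').mpr (fun h => h2 (Int.natCast_dvd.mpr h))
        have hℓ₁'q : ℓ₁'.Coprime q := hqcop ℓ₁' hℓ₁'b hℓ₁'d_nat hℓ₁'d'_nat
        refine ⟨1, ℓ₁ * ℓ₁', by rw [hSdef]; ring, zero_lt_one, ht, Nat.coprime_one_left _, htn₁,
          ?_, one_dvd _, dvd_rfl⟩
        exact (Nat.Coprime.mul_left (Nat.Coprime.mul_left hℓ₁q hℓ₁'q) hn₁q).symm
  obtain ⟨s₁, t₂, hSfac, hs₁, ht₂, hcop12, htn, hqs, hs₁q, ht₂dvd⟩ := hcases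
  have hclass : ∀ y₁ y₂ : ℤ, y₁ ≤ y₂ → ((y₂ - y₁ : ℤ) : ℝ) ≤ (N₂ : ℝ) - N₁ →
      ‖∑ x ∈ (Finset.Ioc y₁ y₂).filter (fun x : ℤ =>
          x ≡ (n₀ : ℤ) [ZMOD q] ∧ (Int.gcd x S = 1 ∧ Int.gcd x δ = 1)), g x‖ ≤ B' := by
    intro y₁ y₂ hy hyR
    simp only [hg]
    refine (BC_class_sum2_le hSfac rfl hs₁ ht₂ hn₁ hcop12 htn hq hqs hs₁q hδ0 hδq haΔ hlam1
      (hat' t₂ ht₂dvd ht₂) (n₀ : ℤ) y₁ y₂ hy hyR).trans ?_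
    have h1 : 0 ≤ (N₂ : ℝ) - N₁ + 3 := by
      have : (N₁ : ℝ) ≤ N₂ := by exact_mod_cast hN
      linarith
    have h2 : 0 ≤ 1 + Real.log (S : ℝ) := by
      have := Real.log_nonneg (show (1 : ℝ) ≤ S by exact_mod_cast hS0); linarith
    have h3 : 0 ≤ lam := le_trans zero_le_one hlam1
    have hg0 : (0 : ℝ) ≤ (Int.gcd Δ n₁ : ℝ) := Nat.cast_nonneg _
    have hA : 0 ≤ ((N₂ : ℝ) - N₁ + 3) * (Int.gcd Δ n₁ : ℝ) / n₁ :=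
      div_nonneg (mul_nonneg h1 hg0) (Nat.cast_nonneg _)
    have hBB : 0 ≤ (S.divisors.card : ℝ) * Real.sqrt S * lam * Real.sqrt (Int.gcd Δ n₁) *
        (1 + Real.log S) :=
      mul_nonneg (mul_nonneg (mul_nonneg (mul_nonneg (Nat.cast_nonneg _) (Real.sqrt_nonneg _))
        h3) (Real.sqrt_nonneg _)) h2
    have hX0 : 0 ≤ 2 * (((N₂ : ℝ) - N₁ + 3) * (Int.gcd Δ n₁ : ℝ) / n₁ +
        (S.divisors.card : ℝ) * Real.sqrt S * lam * Real.sqrt (Int.gcd Δ n₁) *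
          (1 + Real.log S)) := by linarith
    calc ((Nat.divisors δ).card : ℝ) * (2 * (((N₂ : ℝ) - N₁ + 3) * (Int.gcd Δ n₁ : ℝ) / n₁ +
          (S.divisors.card : ℝ) * Real.sqrt S * lam * Real.sqrt (Int.gcd Δ n₁) *
            (1 + Real.log S)))
        ≤ ((Nat.divisors (ℓ₂ * ℓ₂')).card : ℝ) * (2 * (((N₂ : ℝ) - N₁ + 3) * (Int.gcd Δ n₁ : ℝ) / n₁ +
          (S.divisors.card : ℝ) * Real.sqrt S * lam * Real.sqrt (Int.gcd Δ n₁) *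
            (1 + Real.log S))) := mul_le_mul_of_nonneg_right hτδ hX0
      _ = B' := by rw [hB']
  -- Step 7d: Abel summation against the smooth phase `F = e(ρ₀ + ρ₁ + ρ₂)`
  have hx₁x₂ : x₁ < x₂ := by
    have := (Finset.mem_Ioc.mp (Finset.mem_filter.mp hn₀mem).1)
    omega
  have hpartial : ∀ y : ℤ, x₁ ≤ y → y ≤ x₂ → ‖∑ x ∈ (Finset.Ioc x₁ y).filter (fun x : ℤ =>
      x ≡ (n₀ : ℤ) [ZMOD q] ∧ (Int.gcd x S = 1 ∧ Int.gcd x δ = 1)), g x‖ ≤ B' := by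
    intro y hy1 hy2
    refine hclass x₁ y hy1 ?_
    have hx₂r : (x₂ : ℝ) ≤ N₂ := by exact_mod_cast hx₂
    have hx₁r : (N₁ : ℝ) ≤ x₁ := by exact_mod_cast hx₁
    have hyr : (y : ℝ) ≤ x₂ := by exact_mod_cast hy2
    push_cast; linarith
  -- signs and sizes of the complementary divisors on the interval
  have hkey : ∀ (l l₂ : ℕ) (dd : ℤ), (∀ x : ℤ, x ∈ Finset.Ioc x₁ x₂ → RealJ l l₂ dd x) →
      ∀ x : ℤ, x ∈ Set.Icc (x₁ + 1) x₂ →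
        (M₁ : ℝ) < (((l * n₁ : ℕ) : ℝ) - (l₂ : ℝ) * x) / (dd : ℝ) := by
    intro l l₂ dd hR x hx
    have hx' : x ∈ Finset.Ioc x₁ x₂ := by
      rw [Finset.mem_Ioc]; exact ⟨by linarith [hx.1], hx.2⟩
    have h := (hR x hx').1
    push_cast at h ⊢
    linarith [h]
  obtain ⟨hsign₁, habs₁⟩ := BC_pair_sign_abs ℓ₁ ℓ₂ n₁ M₁ hd hM₁ x₁ x₂
    (hkey ℓ₁ ℓ₂ d (fun x hx => (hRealIoc x hx).1))
  obtain ⟨hsign₂, habs₂⟩ := BC_pair_sign_abs ℓ₁' ℓ₂' n₁ M₁ hd' hM₁ x₁ x₂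
    (hkey ℓ₁' ℓ₂' d' (fun x hx => (hRealIoc x hx).2))
  have hx₁pos : 0 < x₁ + 1 := by
    have : (0 : ℤ) ≤ N₁ := by positivity
    omega
  have hmono : ∀ i ∈ (Finset.univ : Finset (Fin 3)),
      MonotoneOn (ρ i) (Set.Icc (x₁ + 1) x₂) ∨ AntitoneOn (ρ i) (Set.Icc (x₁ + 1) x₂) := by
    intro i _
    fin_cases i
    · simp only [hρ, Fin.zero_eta, Matrix.cons_val_zero]
      exact BC_monotoneOn_const_div C₀ hx₁pos
    · simp only [hρ, Fin.mk_one, Matrix.cons_val_one]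
      exact BC_monotoneOn_const_div_affine C₁ _ _ (Nat.cast_nonneg _) hsign₁
    · simp only [hρ, Fin.reduceFinMk, Matrix.cons_val_two, Matrix.tail_cons, Matrix.head_cons]
      exact BC_monotoneOn_const_div_affine C₂ _ _ (Nat.cast_nonneg _) hsign₂
  have habel := BC_abel_exp_monotone_le (Finset.univ : Finset (Fin 3)) ρ hx₁x₂
    (fun x : ℤ => x ≡ (n₀ : ℤ) [ZMOD q] ∧ (Int.gcd x S = 1 ∧ Int.gcd x δ = 1)) g hB'0 hpartial hmono
  refine habel.trans ?_
  -- Step 7e: the total variation of the three pieces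
  rw [hRHS]
  apply mul_le_mul_of_nonneg_left _ hB'0
  rw [hTWF]
  have hx₁mem : x₁ + 1 ∈ Set.Icc (x₁ + 1) x₂ := ⟨le_rfl, by omega⟩
  have hx₂mem : x₂ ∈ Set.Icc (x₁ + 1) x₂ := ⟨by omega, le_rfl⟩
  have hM₁r : (0 : ℝ) < M₁ := by exact_mod_cast hM₁
  have h0 : |ρ 0 (x₁ + 1) - ρ 0 x₂| ≤ |C₀| / ((N₁ : ℝ) + 1) := by
    simp only [hρ, Matrix.cons_val_zero]
    exact BC_pair_piece0_tv C₀ N₁ hx₁ (by omega)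
  have h1 : |ρ 1 (x₁ + 1) - ρ 1 x₂| ≤ 2 * |C₁| / ((|d| : ℝ) * M₁) := by
    simp only [hρ, Matrix.cons_val_one]
    exact BC_pair_piece_tv C₁ ℓ₁ ℓ₂ n₁ M₁ hM₁ hd (x₁ + 1) x₂ (habs₁ _ hx₁mem) (habs₁ _ hx₂mem)
  have h2 : |ρ 2 (x₁ + 1) - ρ 2 x₂| ≤ 2 * |C₂| / ((|d'| : ℝ) * M₁) := by
    simp only [hρ, Matrix.cons_val_two, Matrix.tail_cons, Matrix.head_cons]
    exact BC_pair_piece_tv C₂ ℓ₁' ℓ₂' n₁ M₁ hM₁ hd' (x₁ + 1) x₂ (habs₂ _ hx₁mem) (habs₂ _ hx₂mem)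
  rw [Fin.sum_univ_three]
  have hπ : 0 ≤ 2 * Real.pi := by positivity
  have hsum : |ρ 0 (x₁ + 1) - ρ 0 x₂| + |ρ 1 (x₁ + 1) - ρ 1 x₂| + |ρ 2 (x₁ + 1) - ρ 2 x₂| ≤
      |C₀| / ((N₁ : ℝ) + 1) + 2 * |C₁| / ((|d| : ℝ) * M₁) + 2 * |C₂| / ((|d'| : ℝ) * M₁) := by
    linarith
  linarith [mul_le_mul_of_nonneg_left hsum hπ]

end Literature.NumberTheory.LFunctions

end
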